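import Literature.Topology.FourManifolds.FoxMilnorBand
import Literature.Topology.FourManifolds.KnotOfClosedCurve
import Mathlib.Algebra.Order.ToIntervalMod
import Mathlib.Analysis.SpecialFunctions.Trigonometric.Bounds
import HarnessLib

/-!
# Fox–Milnor symmetric model, III: the symmetric union as a regular closed curve

Topic `Literature/Topology/FourManifolds`. Sequel of `FoxMilnorChart.lean` / `FoxMilnorBand.lean`
(flat model `Φ`: a knot `A = Φ.A` in the open northern hemisphere with a straight chart segment,
and the radial band `Φ.band` of the symmetric connected sum `A # (-Ā)`, `-Ā = A.mirror.reverse =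
R ∘ A ∘ r`, `R` the reflection in the equator). This file writes down **the symmetric union
itself** as an explicit regular simple closed curve and hence as a knot (`KnotOfClosedCurve.lean`):

* the *plateau*: the ray of the band at height `x₁ = h` parametrised by the angle `θ` from the
  equator, `band (Xr h θ, h) = cos θ · U⁻¹ â + sin θ · e₃` (`coe_band_Xr`), where
  `Xr h θ = 1/2 + log (rayR θ / 2) / (2 L h)`; the identity `rayR θ · rayR (-θ) = 4` makes
  `Xr h θ + Xr h (-θ) = 1`, i.e. the angle parametrisation runs smoothly THROUGH the equator and
  is compatible with the symmetry `(x₀, x₁) ↦ (1 - x₀, x₁)` of the band square;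
* the *corners* `corner h σ`: planar curves `((1 - χ) · Xr h, h + σ κ⁻¹ (s - t₁) χ)`,
  `χ = smoothStep t₁ (1/4)`, turning from the plateau (for `s ≤ t₁`) into the edge line `x₀ = 0`
  read affinely (for `s ≥ 1/4`), where the band IS the knot `A` (`band (0, x₁) = A (θaff x₁)`,
  `θaff` affine);
* the *northern half-curve* `γN`: upper corner at height `1`, then `A` itself through the smooth
  increasing reparametrisation `τ` (slope `1` at both ends, absorbing the mismatch of the two
  affine readings), then the lower corner at height `0`; the **symmetric curve** `γ` is `γN` on
  `[0, π]` and `R ∘ γN ∘ (-)` on `[-π, 0]`, extended `2π`-periodically;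
* `γ` is `C^∞`, regular, on the sphere, injective modulo `2π` (`symCurve_eq_iff`), so it is a knot
  `Φ.symKnot` (`IsRegularClosedCurve.toKnot`), which is symmetric (`symKnot_isSymmetric`), maps the
  open upper semicircle into the open northern hemisphere and is the standard vertical great circle
  near its two equator points; by the chord disc theorem (`Knot.isSmoothlySlice_of_symmetric`,
  `BandSumFoxMilnor.lean`) **`Φ.symKnot` is smoothly slice** (`symKnot_isSmoothlySlice`).

The sequel `FoxMilnorSymmetricUnion.lean` shows that `Φ.symKnot` is a regular normal connected sum
of `A` and `-Ā` along `Φ.band`, which gives the symmetric-union input of Fox–Milnor's theorem in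
the printed (regular normal) reading. Everything here is proved; no named facts (D-0026).

## References

* R. H. Fox, J. W. Milnor, *Singularities of 2-spheres in 4-space and cobordism of knots*, Osaka
  J. Math. 3 (1966), 257–267, §1 and §3, Lemma 3. [FoxMilnor1966]
* C. Livingston, *A survey of classical knot concordance*, Handbook of Knot Theory (2005), §2.1.
  [Livingston2005]
* R. H. Crowell, R. H. Fox, *Introduction to Knot Theory*, GTM 57, Ch. I §2 (differentiable knots
  as regular simple closed curves).

## Design notes

No statement of another file is modified; no named fact is introduced; no `sorry`. `𝔼 n`, `𝕊 n`
are local notation as in `Knots.lean`. The southern half of every object is obtained from the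
northern one by the reflection `R` (`reflectLast 3`, `refl4` on vectors) resp. the flip `sflip` of
the band square, never written out a second time.
-/

open scoped Manifold ContDiff Topology Real RealInnerProductSpace
open Function Set Metric

noncomputable section

namespace Literature.Topology.FourManifolds

/-- Local notation: `𝔼 n` is the model Euclidean space `EuclideanSpace ℝ (Fin n)`. -/
local notation "𝔼 " n:arg => EuclideanSpace ℝ (Fin n)

/-- Local notation: `𝕊 n` is the unit sphere in `EuclideanSpace ℝ (Fin (n + 1))`. -/
local notation "𝕊 " n:arg => (Metric.sphere (0 : EuclideanSpace ℝ (Fin (n + 1))) 1)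

attribute [local instance] fact_finrank_euclideanSpace_succ

namespace FoxMilnorModel

open KnotsInBall Knot.SymmetricUnion BandSumUnit

/-! ## More on the rays of the chart -/

/-- `1 + sin θ ≠ 0` and `1 - sin θ ≠ 0` as soon as `cos θ ≠ 0`. [folklore] -/
theorem one_add_sin_ne_zero_of_cos_ne_zero {θ : ℝ} (h : Real.cos θ ≠ 0) : 1 + Real.sin θ ≠ 0 := by
  intro h'
  apply h
  nlinarith [Real.cos_sq_add_sin_sq θ, sq_nonneg (Real.cos θ)]

/-- `0 < 1 + sin θ` as soon as `cos θ ≠ 0`. [folklore] -/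
theorem one_add_sin_pos_of_cos_ne_zero {θ : ℝ} (h : Real.cos θ ≠ 0) : 0 < 1 + Real.sin θ :=
  lt_of_le_of_ne (by linarith [Real.neg_one_le_sin θ]) (one_add_sin_ne_zero_of_cos_ne_zero h).symm

/-- The rays are positive on `cos θ > 0`. [folklore] -/
theorem rayR_pos {θ : ℝ} (h : 0 < Real.cos θ) : 0 < rayR θ :=
  div_pos (by linarith) (one_add_sin_pos_of_cos_ne_zero h.ne')

/-- `rayR 0 = 2` (the equator). [folklore] -/
@[simp] theorem rayR_zero : rayR 0 = 2 := by simp [rayR]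

/-- **`rayR θ · rayR (-θ) = 4`**: the inversion in the sphere of radius `2` reverses the angle.
[folklore] -/
theorem rayR_mul_rayR_neg {θ : ℝ} (h : Real.cos θ ≠ 0) : rayR θ * rayR (-θ) = 4 := by
  have h1 := one_add_sin_ne_zero_of_cos_ne_zero h
  have h2 : 1 - Real.sin θ ≠ 0 := by
    intro h'
    apply h
    nlinarith [Real.cos_sq_add_sin_sq θ, sq_nonneg (Real.cos θ)]
  rw [rayR, rayR, Real.cos_neg, Real.sin_neg, ← sub_eq_add_neg]
  field_simp
  nlinarith [Real.cos_sq_add_sin_sq θ]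

/-- The derivative of `rayR` is `-2 / (1 + sin θ)`. [folklore] -/
theorem hasDerivAt_rayR {θ : ℝ} (h : Real.cos θ ≠ 0) :
    HasDerivAt rayR (-2 / (1 + Real.sin θ)) θ := by
  have h1 := one_add_sin_ne_zero_of_cos_ne_zero h
  have hd : HasDerivAt (fun θ ↦ 2 * Real.cos θ / (1 + Real.sin θ))
      ((2 * -Real.sin θ * (1 + Real.sin θ) - 2 * Real.cos θ * Real.cos θ) / (1 + Real.sin θ) ^ 2) θ :=
    ((Real.hasDerivAt_cos θ).const_mul 2).div ((Real.hasDerivAt_sin θ).const_add 1) h1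
  have he : (2 * -Real.sin θ * (1 + Real.sin θ) - 2 * Real.cos θ * Real.cos θ) / (1 + Real.sin θ) ^ 2
      = -2 / (1 + Real.sin θ) := by
    field_simp
    nlinarith [Real.cos_sq_add_sin_sq θ]
  rw [he] at hd
  exact hd

/-- `rayR ≤ 2` for `θ ∈ [0, π/2)`... more precisely whenever `0 ≤ sin θ` and `cos θ ≤ 1`. [folklore] -/
theorem rayR_le_two {θ : ℝ} (hs : 0 ≤ Real.sin θ) : rayR θ ≤ 2 := by
  rw [rayR, div_le_iff₀ (by linarith)]
  nlinarith [Real.cos_le_one θ]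

/-- `rayR < 2` whenever `0 < sin θ`. [folklore] -/
theorem rayR_lt_two {θ : ℝ} (hs : 0 < Real.sin θ) : rayR θ < 2 := by
  rw [rayR, div_lt_iff₀ (by linarith)]
  nlinarith [Real.cos_le_one θ]

/-- A crude lower bound: `31/20 ≤ rayR θ` for `θ ∈ [0, 1/4]` (from `cos θ ≥ 1 - θ²/2`,
`sin θ ≤ θ`). [folklore] -/
theorem rayR_ge {θ : ℝ} (hθ : θ ∈ Icc (0 : ℝ) 4⁻¹) : 31 / 20 ≤ rayR θ := by
  have hc : 1 - θ ^ 2 / 2 ≤ Real.cos θ := Real.one_sub_sq_div_two_le_cos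
  have hs : Real.sin θ ≤ θ := Real.sin_le hθ.1
  have hs' : 0 ≤ Real.sin θ := Real.sin_nonneg_of_nonneg_of_le_pi hθ.1 (by linarith [hθ.2, Real.pi_gt_three])
  have hcpos : 31 / 32 ≤ Real.cos θ := by nlinarith [hθ.1, hθ.2]
  rw [rayR, le_div_iff₀ (by linarith)]
  nlinarith [hθ.2]

/-- `0 < cos θ` for `θ ∈ [0, 1/4]`. [folklore] -/
theorem cos_pos_of_mem_Icc {θ : ℝ} (hθ : θ ∈ Icc (0 : ℝ) 4⁻¹) : 0 < Real.cos θ :=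
  Real.cos_pos_of_mem_Ioo ⟨by linarith [hθ.1, Real.pi_gt_three], by linarith [hθ.2, Real.pi_gt_three]⟩

/-- The reflection reverses the angle along a ray: `R (cos θ · U⁻¹ a + sin θ · e₃) =
cos (-θ) · U⁻¹ a + sin (-θ) · e₃`. [folklore] -/
theorem refl4_ray (a : 𝔼 3) (θ : ℝ) :
    refl4 (Real.cos θ • uvec a + Real.sin θ • e3) = Real.cos (-θ) • uvec a + Real.sin (-θ) • e3 := by
  rw [map_add, map_smul, map_smul, refl4_uvec, refl4_e3, Real.cos_neg, Real.sin_neg, smul_neg, neg_smul]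

namespace FlatModel

variable (Φ : FlatModel)

/-! ## Constants of the symmetric model -/

/-- The collar width `δ = min (ν/2) (1/2)` of the symmetric model (so that the band meets `A`, `B`
only in its edge lines, `band_mem_range_A_iff`). [folklore] -/
def δs : ℝ := min (Φ.ν / 2) 2⁻¹

/-- `δ > 0`. [folklore] -/
theorem δs_pos : 0 < Φ.δs := lt_min (by linarith [Φ.ν_pos]) (by norm_num)

/-- `δ ≤ ν/2`. [folklore] -/
theorem δs_le_nu : Φ.δs ≤ Φ.ν / 2 := min_le_left _ _

/-- `δ ≤ 1/2`. [folklore] -/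
theorem δs_le_half : Φ.δs ≤ 2⁻¹ := min_le_right _ _

/-- `δ ≤ 1`. [folklore] -/
theorem δs_le_one : Φ.δs ≤ 1 := Φ.δs_le_half.trans (by norm_num)

/-- The angular width `w = min (κ δ) (1/4) / 2` of the corners. [folklore] -/
def ws : ℝ := min (Φ.κ * Φ.δs) 4⁻¹ / 2

/-- `w > 0`. [folklore] -/
theorem ws_pos : 0 < Φ.ws := by
  unfold ws
  have := mul_pos Φ.κ_pos Φ.δs_pos
  positivity

/-- `w ≤ κ δ / 2`. [folklore] -/
theorem ws_le : Φ.ws ≤ Φ.κ * Φ.δs / 2 := by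
  unfold ws; linarith [min_le_left (Φ.κ * Φ.δs) 4⁻¹]

/-- `w ≤ 1/8`. [folklore] -/
theorem ws_le_eighth : Φ.ws ≤ 8⁻¹ := by
  unfold ws; linarith [min_le_right (Φ.κ * Φ.δs) 4⁻¹]

/-- `κ δ ≤ 1/2`. [folklore] -/
theorem κ_mul_δs_le : Φ.κ * Φ.δs ≤ 2⁻¹ := by
  have := mul_le_mul Φ.κ_le_one Φ.δs_le_half Φ.δs_pos.le zero_le_one
  linarith

/-- The angle `t₁ = 1/4 - w` at which the corners begin (end of the plateaux). [folklore] -/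
def t1 : ℝ := 4⁻¹ - Φ.ws

/-- `1/8 ≤ t₁`. [folklore] -/
theorem eighth_le_t1 : 8⁻¹ ≤ Φ.t1 := by unfold t1; linarith [Φ.ws_le_eighth]

/-- `0 < t₁`. [folklore] -/
theorem t1_pos : 0 < Φ.t1 := by linarith [Φ.eighth_le_t1]

/-- `t₁ < 1/4`. [folklore] -/
theorem t1_lt : Φ.t1 < 4⁻¹ := by unfold t1; linarith [Φ.ws_pos]

/-- `1/4 - t₁ = w ≤ κ δ / 2`. [folklore] -/
theorem quarter_sub_t1 : 4⁻¹ - Φ.t1 = Φ.ws := by unfold t1; ring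

/-- The transition `χ = smoothStep t₁ (1/4)` of the corners. [folklore] -/
def χ : ℝ → ℝ := smoothStep Φ.t1 4⁻¹

/-- `χ` is smooth. [folklore] -/
theorem contDiff_χ : ContDiff ℝ ∞ Φ.χ := contDiff_smoothStep _ _

/-- `χ = 0` left of `t₁`. [folklore] -/
theorem χ_of_le {s : ℝ} (hs : s ≤ Φ.t1) : Φ.χ s = 0 := smoothStep_of_le Φ.t1_lt hs

/-- `χ = 1` right of `1/4`. [folklore] -/
theorem χ_of_ge {s : ℝ} (hs : 4⁻¹ ≤ s) : Φ.χ s = 1 := smoothStep_of_ge Φ.t1_lt hs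

/-- `χ ∈ [0, 1]`. [folklore] -/
theorem χ_mem (s : ℝ) : Φ.χ s ∈ Icc (0 : ℝ) 1 := smoothStep_mem_Icc _ _ _

/-- `χ ∈ (0, 1)` strictly inside the corner. [folklore] -/
theorem χ_mem_Ioo {s : ℝ} (hs : s ∈ Ioo Φ.t1 4⁻¹) : Φ.χ s ∈ Ioo (0 : ℝ) 1 :=
  smoothStep_mem_Ioo Φ.t1_lt hs

/-- `χ' ≥ 0`. [folklore] -/
theorem deriv_χ_nonneg (s : ℝ) : 0 ≤ deriv Φ.χ s := deriv_smoothStep_nonneg Φ.t1_lt s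

/-- `χ` is differentiable. [folklore] -/
theorem hasDerivAt_χ (s : ℝ) : HasDerivAt Φ.χ (deriv Φ.χ s) s :=
  ((Φ.contDiff_χ.differentiable (by simp)) s).hasDerivAt

/-- `χ' = 0` right of `1/4`. [folklore] -/
theorem deriv_χ_of_gt {s : ℝ} (hs : 4⁻¹ < s) : deriv Φ.χ s = 0 := deriv_smoothStep_of_gt Φ.t1_lt hs

/-- `χ' = 0` left of `t₁`. [folklore] -/
theorem deriv_χ_of_lt {s : ℝ} (hs : s < Φ.t1) : deriv Φ.χ s = 0 := deriv_smoothStep_of_lt Φ.t1_lt hs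

/-- `χ' (1/4) = 0`. [folklore] -/
theorem deriv_χ_quarter : deriv Φ.χ 4⁻¹ = 0 := deriv_smoothStep_right Φ.t1_lt

/-- `χ' (t₁) = 0`. [folklore] -/
theorem deriv_χ_t1 : deriv Φ.χ Φ.t1 = 0 := deriv_smoothStep_left _ _

/-! ## The unit directions of the rays and the angular coordinate of the plateaux -/

/-- The unit chart direction `â (h) = (q + S h e) / ‖q + S h e‖` of the ray through the left edge
point at height `h`. [folklore] -/
def dir (h : ℝ) : 𝔼 3 := ‖Φ.segPt h‖⁻¹ • Φ.segPt h

/-- `‖â‖ = 1`. [folklore] -/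
@[simp] theorem norm_dir (h : ℝ) : ‖Φ.dir h‖ = 1 := by
  have hn : 0 < ‖Φ.segPt h‖ := by linarith [Φ.one_le_norm_segPt h]
  rw [dir, norm_smul, Real.norm_eq_abs, abs_of_pos (inv_pos.2 hn), inv_mul_cancel₀ hn.ne']

/-- **The angular coordinate of the plateau at height `h`**: the band point `(Xr h θ, h)` is the
point of the ray through `(0, h)` at angle `θ` from the equator,
`Xr h θ = 1/2 + log (rayR θ / 2) / (2 L h)`. [folklore] -/
def Xr (h θ : ℝ) : ℝ := 2⁻¹ + Real.log (rayR θ / 2) / (2 * Φ.L h)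

/-- `Xr h 0 = 1/2` (the equator is the middle line). [folklore] -/
@[simp] theorem Xr_zero (h : ℝ) : Φ.Xr h 0 = 2⁻¹ := by simp [Xr]

/-- **The band chart on the plateau is the ray**: `bandChart (Xr h θ, h) = rayR θ · â h` (for
`cos θ > 0` and `h` on the collar). [folklore] -/
theorem bandChart_Xr {h θ : ℝ} (hh : h ∈ Ioo (-1 : ℝ) 2) (hθ : 0 < Real.cos θ) :
    Φ.bandChart (pt2 (Φ.Xr h θ) h) = rayR θ • Φ.dir h := by
  have hL := Φ.L_pos hh
  have hr := rayR_pos hθ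
  have hn : 0 < ‖Φ.segPt h‖ := by linarith [Φ.one_le_norm_segPt h]
  rw [bandChart, μb, pt2_apply_zero, pt2_apply_one, dir, smul_smul]
  congr 1
  have h1 : 2 * Φ.Xr h θ * Φ.L h = Φ.L h + Real.log (rayR θ / 2) := by
    unfold Xr; field_simp
  rw [h1, Real.exp_add, Φ.exp_L, Real.exp_log (by positivity)]
  field_simp

/-- **The band on the plateau is the vertical great circle through `U⁻¹ â`**, parametrised by the
angle from the equator: `band (Xr h θ, h) = cos θ · U⁻¹ â + sin θ · e₃`. [folklore] -/
theorem coe_band_Xr {h θ : ℝ} (hh : h ∈ Ioo (-1 : ℝ) 2) (hθ : 0 < Real.cos θ) :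
    ((Φ.band (pt2 (Φ.Xr h θ) h) : 𝕊 3) : 𝔼 4) = Real.cos θ • uvec (Φ.dir h) + Real.sin θ • e3 := by
  rw [coe_band, Φ.bandChart_Xr hh hθ, phi_ray (Φ.norm_dir h) (one_add_sin_ne_zero_of_cos_ne_zero hθ.ne')]

/-- **The symmetry of the angular coordinate**: `Xr h θ + Xr h (-θ) = 1`. [folklore] -/
theorem Xr_add_Xr_neg {h θ : ℝ} (hθ : 0 < Real.cos θ) : Φ.Xr h θ + Φ.Xr h (-θ) = 1 := by
  have h1 := rayR_pos hθ
  have h2 : 0 < rayR (-θ) := rayR_pos (by rwa [Real.cos_neg])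
  have hlog : Real.log (rayR θ / 2) + Real.log (rayR (-θ) / 2) = 0 := by
    rw [← Real.log_mul (by positivity) (by positivity),
      show rayR θ / 2 * (rayR (-θ) / 2) = rayR θ * rayR (-θ) / 4 by ring, rayR_mul_rayR_neg hθ.ne']
    norm_num
  unfold Xr
  rw [show (2⁻¹ : ℝ) + Real.log (rayR θ / 2) / (2 * Φ.L h) + (2⁻¹ + Real.log (rayR (-θ) / 2) / (2 * Φ.L h))
      = 1 + (Real.log (rayR θ / 2) + Real.log (rayR (-θ) / 2)) / (2 * Φ.L h) by ring, hlog]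
  simp

/-- The derivative of the angular coordinate: `Xr' = -1 / (2 L cos θ)`. [folklore] -/
theorem hasDerivAt_Xr {h θ : ℝ} (hθ : 0 < Real.cos θ) :
    HasDerivAt (Φ.Xr h) (-(2 * Φ.L h * Real.cos θ)⁻¹) θ := by
  have hr := rayR_pos hθ
  have hs := one_add_sin_pos_of_cos_ne_zero hθ.ne'
  have h1 : HasDerivAt (fun θ ↦ rayR θ / 2) (-2 / (1 + Real.sin θ) / 2) θ :=
    (hasDerivAt_rayR hθ.ne').div_const 2
  have h2 : HasDerivAt (fun θ ↦ Real.log (rayR θ / 2)) ((-2 / (1 + Real.sin θ) / 2) / (rayR θ / 2)) θ :=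
    h1.log (by positivity)
  have h3 := (h2.div_const (2 * Φ.L h)).const_add (2⁻¹ : ℝ)
  have he : -2 / (1 + Real.sin θ) / 2 / (rayR θ / 2) / (2 * Φ.L h) = -(2 * Φ.L h * Real.cos θ)⁻¹ := by
    rw [rayR]
    field_simp
  rw [he] at h3
  exact h3

/-- The angular coordinate is smooth on `cos θ > 0`. [folklore] -/
theorem contDiffAt_Xr {h θ : ℝ} (hθ : 0 < Real.cos θ) : ContDiffAt ℝ ∞ (Φ.Xr h) θ := by
  have hr := rayR_pos hθ
  have hs := one_add_sin_pos_of_cos_ne_zero hθ.ne'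
  unfold Xr rayR
  have h1 : ContDiffAt ℝ ∞ (fun θ ↦ 2 * Real.cos θ / (1 + Real.sin θ) / 2) θ :=
    ((contDiff_const.mul Real.contDiff_cos).contDiffAt.div
      (contDiff_const.add Real.contDiff_sin).contDiffAt hs.ne').div_const 2
  refine contDiffAt_const.add ((h1.log ?_).div_const _)
  have : 0 < 2 * Real.cos θ / (1 + Real.sin θ) / 2 := by positivity
  exact this.ne'

/-- `Xr' < 0` on the collar, where `cos θ > 0`. [folklore] -/
theorem deriv_Xr_neg {h θ : ℝ} (hh : h ∈ Ioo (-1 : ℝ) 2) (hθ : 0 < Real.cos θ) :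
    deriv (Φ.Xr h) θ < 0 := by
  rw [(Φ.hasDerivAt_Xr hθ).deriv, neg_lt_zero, inv_pos]
  exact mul_pos (mul_pos two_pos (Φ.L_pos hh)) hθ

/-- `Xr` is strictly decreasing on `[0, 1/2]` (inside `cos > 0`). [folklore] -/
theorem strictAntiOn_Xr {h : ℝ} (hh : h ∈ Ioo (-1 : ℝ) 2) : StrictAntiOn (Φ.Xr h) (Icc (-2⁻¹) 2⁻¹) := by
  have hcos : ∀ θ ∈ Icc (-2⁻¹ : ℝ) 2⁻¹, 0 < Real.cos θ := fun θ hθ ↦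
    Real.cos_pos_of_mem_Ioo ⟨by linarith [hθ.1, Real.pi_gt_three], by linarith [hθ.2, Real.pi_gt_three]⟩
  refine strictAntiOn_of_deriv_neg (convex_Icc _ _)
    (fun θ hθ ↦ (Φ.contDiffAt_Xr (hcos θ hθ)).continuousAt.continuousWithinAt) fun θ hθ ↦ ?_
  exact Φ.deriv_Xr_neg hh (hcos θ (interior_subset hθ))

/-- `Xr h θ < 1/2` for `θ ∈ (0, 1/2]`. [folklore] -/
theorem Xr_lt_half {h θ : ℝ} (hh : h ∈ Ioo (-1 : ℝ) 2) (hθ : θ ∈ Ioc (0 : ℝ) 2⁻¹) : Φ.Xr h θ < 2⁻¹ := by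
  have := Φ.strictAntiOn_Xr hh ⟨by norm_num, by norm_num⟩ ⟨by linarith [hθ.1], hθ.2⟩ hθ.1
  rwa [Xr_zero] at this

/-- `Xr h θ ≤ 1/2` for `θ ∈ [0, 1/2]`. [folklore] -/
theorem Xr_le_half {h θ : ℝ} (hh : h ∈ Ioo (-1 : ℝ) 2) (hθ : θ ∈ Icc (0 : ℝ) 2⁻¹) : Φ.Xr h θ ≤ 2⁻¹ := by
  rcases hθ.1.eq_or_lt with h0 | h0
  · rw [← h0, Xr_zero]
  · exact (Φ.Xr_lt_half hh ⟨h0, hθ.2⟩).le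

/-- **The plateau stays inside the band**: `0 < Xr h θ` for `θ ∈ [0, 1/4]` (the ray at angle
`≤ 1/4` has chart radius `≥ 31/20 > √(5/4) > ‖q + S e‖`). [folklore] -/
theorem Xr_pos {h θ : ℝ} (hh : h ∈ Ioo (-1 : ℝ) 2) (hθ : θ ∈ Icc (0 : ℝ) 4⁻¹) : 0 < Φ.Xr h θ := by
  have hL := Φ.L_pos hh
  have hr := rayR_ge hθ
  have hn : 0 < ‖Φ.segPt h‖ := by linarith [Φ.one_le_norm_segPt h]
  have hseg : ‖Φ.segPt h‖ < 31 / 20 := by nlinarith [Φ.norm_segPt_sq_lt hh, norm_nonneg (Φ.segPt h)]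
  -- `log (rayR θ / 2) > -L h = log (‖segPt h‖ / 2)`
  have h1 : -Φ.L h = Real.log (‖Φ.segPt h‖ / 2) := by
    have := Φ.exp_L h
    rw [← Real.log_exp (-Φ.L h), Real.exp_neg, this, inv_div]
  have h2 : Real.log (‖Φ.segPt h‖ / 2) < Real.log (rayR θ / 2) :=
    Real.log_lt_log (by positivity) (by linarith)
  unfold Xr
  rw [← h1] at h2
  have h3 : -(2⁻¹ : ℝ) < Real.log (rayR θ / 2) / (2 * Φ.L h) := by
    rw [lt_div_iff₀ (by positivity)]; linarith
  linarith

/-! ## The corners -/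

/-- **The corner at height `h`, direction `σ = ±1`**: the planar curve
`s ↦ ((1 - χ s) Xr h s, h + σ κ⁻¹ (s - t₁) χ s)` — the plateau `(Xr h s, h)` for `s ≤ t₁`, the edge
line `x₀ = 0` read affinely, `(0, h + σ κ⁻¹ (s - t₁))`, for `s ≥ 1/4`. [folklore] -/
def corner (h σ s : ℝ) : 𝔼 2 :=
  pt2 ((1 - Φ.χ s) * Φ.Xr h s) (h + σ * Φ.κ⁻¹ * (s - Φ.t1) * Φ.χ s)

/-- First coordinate of the corner. [folklore] -/
@[simp] theorem corner_apply_zero (h σ s : ℝ) : Φ.corner h σ s 0 = (1 - Φ.χ s) * Φ.Xr h s := rfl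

/-- Second coordinate of the corner. [folklore] -/
@[simp] theorem corner_apply_one (h σ s : ℝ) :
    Φ.corner h σ s 1 = h + σ * Φ.κ⁻¹ * (s - Φ.t1) * Φ.χ s := rfl

/-- On the plateau (`s ≤ t₁`) the corner is `(Xr h s, h)`. [folklore] -/
theorem corner_of_le {h σ s : ℝ} (hs : s ≤ Φ.t1) : Φ.corner h σ s = pt2 (Φ.Xr h s) h := by
  rw [corner, Φ.χ_of_le hs]; simp

/-- On the edge (`1/4 ≤ s`) the corner is `(0, h + σ κ⁻¹ (s - t₁))`. [folklore] -/
theorem corner_of_ge {h σ s : ℝ} (hs : 4⁻¹ ≤ s) :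
    Φ.corner h σ s = pt2 0 (h + σ * Φ.κ⁻¹ * (s - Φ.t1)) := by
  rw [corner, Φ.χ_of_ge hs]; simp

/-- The first coordinate `(1 - χ) Xr h` of the corner is smooth on `(-1/2, ∞)`: either
`cos s > 0`, or `χ = 1` near `s`. [folklore] -/
theorem contDiffAt_corner_fst (h : ℝ) {s : ℝ} (hs : -2⁻¹ < s) :
    ContDiffAt ℝ ∞ (fun s ↦ (1 - Φ.χ s) * Φ.Xr h s) s := by
  rcases lt_or_ge s 2⁻¹ with h1 | h1
  · have hcos : 0 < Real.cos s :=
      Real.cos_pos_of_mem_Ioo ⟨by linarith [Real.pi_gt_three], by linarith [Real.pi_gt_three]⟩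
    exact (contDiff_const.sub Φ.contDiff_χ).contDiffAt.mul (Φ.contDiffAt_Xr hcos)
  · have hev : (fun s ↦ (1 - Φ.χ s) * Φ.Xr h s) =ᶠ[𝓝 s] fun _ ↦ 0 := by
      filter_upwards [Ioi_mem_nhds (show (4⁻¹ : ℝ) < s by linarith)] with t ht
      rw [Φ.χ_of_ge (le_of_lt ht)]; ring
    exact contDiffAt_const.congr_of_eventuallyEq hev

/-- The second coordinate of the corner is smooth. [folklore] -/
theorem contDiff_corner_snd (h σ : ℝ) : ContDiff ℝ ∞ fun s ↦ h + σ * Φ.κ⁻¹ * (s - Φ.t1) * Φ.χ s :=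
  contDiff_const.add ((contDiff_const.mul (contDiff_id.sub contDiff_const)).mul Φ.contDiff_χ)

/-- The corner is smooth on the open half-line `(-1/2, ∞)`. [folklore] -/
theorem contDiffAt_corner (h σ : ℝ) {s : ℝ} (hs : -2⁻¹ < s) : ContDiffAt ℝ ∞ (Φ.corner h σ) s := by
  have hu := Φ.contDiffAt_corner_fst h hs
  have hv := (Φ.contDiff_corner_snd h σ).contDiffAt (x := s)
  rw [show Φ.corner h σ =
      (fun p : ℝ × ℝ ↦ pt2 p.1 p.2) ∘ fun s ↦ ((1 - Φ.χ s) * Φ.Xr h s, h + σ * Φ.κ⁻¹ * (s - Φ.t1) * Φ.χ s)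
      from rfl]
  exact (contDiff_pt2 contDiff_fst contDiff_snd).contDiffAt.comp s (hu.prodMk hv)

/-- The corner is smooth on `(-1/2, ∞)` as a `ContDiffOn` statement. [folklore] -/
theorem contDiffOn_corner (h σ : ℝ) : ContDiffOn ℝ ∞ (Φ.corner h σ) (Ioi (-2⁻¹)) :=
  fun _ hs ↦ (Φ.contDiffAt_corner h σ hs).contDiffWithinAt

/-- The derivative of the first coordinate of the corner, for `cos s > 0`. [folklore] -/
theorem hasDerivAt_corner_fst {h σ s : ℝ} (hs : 0 < Real.cos s) :
    HasDerivAt (fun s ↦ Φ.corner h σ s 0)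
      (-deriv Φ.χ s * Φ.Xr h s + (1 - Φ.χ s) * -(2 * Φ.L h * Real.cos s)⁻¹) s := by
  simp only [corner_apply_zero]
  have := ((hasDerivAt_const s (1 : ℝ)).fun_sub (Φ.hasDerivAt_χ s)).fun_mul (Φ.hasDerivAt_Xr (h := h) hs)
  simpa using this

/-- The derivative of the second coordinate of the corner. [folklore] -/
theorem hasDerivAt_corner_snd (h σ s : ℝ) :
    HasDerivAt (fun s ↦ Φ.corner h σ s 1)
      (σ * Φ.κ⁻¹ * (Φ.χ s + (s - Φ.t1) * deriv Φ.χ s)) s := by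
  simp only [corner_apply_one]
  have h1 : HasDerivAt (fun s ↦ σ * Φ.κ⁻¹ * (s - Φ.t1) * Φ.χ s)
      (σ * Φ.κ⁻¹ * 1 * Φ.χ s + σ * Φ.κ⁻¹ * (s - Φ.t1) * deriv Φ.χ s) s :=
    (((hasDerivAt_id s).sub_const Φ.t1).const_mul (σ * Φ.κ⁻¹)).fun_mul (Φ.hasDerivAt_χ s)
  have h2 := h1.const_add h
  have he : σ * Φ.κ⁻¹ * 1 * Φ.χ s + σ * Φ.κ⁻¹ * (s - Φ.t1) * deriv Φ.χ s =
      σ * Φ.κ⁻¹ * (Φ.χ s + (s - Φ.t1) * deriv Φ.χ s) := by ring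
  rw [he] at h2
  exact h2

/-- **The first coordinate of the corner is strictly decreasing before the edge**: for `s < 1/4`
with `cos s > 0` and `0 < Xr h s`, `(corner s)₀' < 0`. [folklore] -/
theorem deriv_corner_fst_neg {h σ s : ℝ} (hh : h ∈ Ioo (-1 : ℝ) 2) (hs : 0 < Real.cos s)
    (hs' : s < 4⁻¹) (hX : 0 < Φ.Xr h s) : deriv (fun s ↦ Φ.corner h σ s 0) s < 0 := by
  rw [(Φ.hasDerivAt_corner_fst (σ := σ) hs).deriv]
  have h1 : 0 ≤ deriv Φ.χ s * Φ.Xr h s := mul_nonneg (Φ.deriv_χ_nonneg s) hX.le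
  have h2 : 0 < 1 - Φ.χ s := by
    rcases le_or_gt s Φ.t1 with h3 | h3
    · rw [Φ.χ_of_le h3]; norm_num
    · linarith [(Φ.χ_mem_Ioo ⟨h3, hs'⟩).2]
  have h3 : 0 < (2 * Φ.L h * Real.cos s)⁻¹ := inv_pos.2 (mul_pos (mul_pos two_pos (Φ.L_pos hh)) hs)
  nlinarith [mul_pos h2 h3]

/-- **The second coordinate of the corner is strictly monotone after the plateau**: for `t₁ < s`,
`σ · (corner s)₁' > 0`... in the form `0 < χ s + (s - t₁) χ' s`. [folklore] -/
theorem corner_snd_factor_pos {s : ℝ} (hs : Φ.t1 < s) : 0 < Φ.χ s + (s - Φ.t1) * deriv Φ.χ s := by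
  have h2 : 0 ≤ (s - Φ.t1) * deriv Φ.χ s := mul_nonneg (by linarith) (Φ.deriv_χ_nonneg s)
  have h1 : 0 < Φ.χ s := by
    rcases lt_or_ge s 4⁻¹ with h3 | h3
    · exact (Φ.χ_mem_Ioo ⟨hs, h3⟩).1
    · rw [Φ.χ_of_ge h3]; norm_num
  linarith

/-- **The corner is a regular curve** on `(-1/2, ∞)` (for `σ ≠ 0` and `h` on the collar): before
`1/4` its first coordinate strictly decreases, after `t₁` its second coordinate strictly moves.
[folklore] -/
theorem deriv_corner_ne_zero {h σ s : ℝ} (hh : h ∈ Ioo (-1 : ℝ) 2) (hσ : σ ≠ 0) (hs : -2⁻¹ < s) :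
    deriv (Φ.corner h σ) s ≠ 0 := by
  intro h0
  -- the derivative of the corner in coordinates
  have hu := ((Φ.contDiffAt_corner_fst h hs).differentiableAt (by simp)).hasDerivAt
  have hv := Φ.hasDerivAt_corner_snd h σ s
  simp only [corner_apply_one] at hv
  have hd : HasDerivAt (Φ.corner h σ) (pt2 (deriv (fun s ↦ (1 - Φ.χ s) * Φ.Xr h s) s)
      (σ * Φ.κ⁻¹ * (Φ.χ s + (s - Φ.t1) * deriv Φ.χ s))) s := hasDerivAt_pt2 hu hv
  rw [hd.deriv, pt2_eq_zero_iff] at h0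
  obtain ⟨hc0, hc1⟩ := h0
  rcases lt_or_ge s 4⁻¹ with h1 | h1
  · -- before the edge: the first coordinate strictly decreases
    have hcos : 0 < Real.cos s :=
      Real.cos_pos_of_mem_Ioo ⟨by linarith [Real.pi_gt_three], by linarith [Real.pi_gt_three]⟩
    have hX : 0 < Φ.Xr h s := by
      rcases le_or_gt 0 s with h2 | h2
      · exact Φ.Xr_pos hh ⟨h2, h1.le⟩
      · have := Φ.strictAntiOn_Xr hh ⟨hs.le, by linarith⟩ ⟨by norm_num, by norm_num⟩ h2
        rw [Xr_zero] at this; linarith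
    have hneg := Φ.deriv_corner_fst_neg (σ := σ) hh hcos h1 hX
    simp only [corner_apply_zero] at hneg
    exact hneg.ne hc0
  · -- on the edge: the second coordinate moves
    have hf := Φ.corner_snd_factor_pos (lt_of_lt_of_le Φ.t1_lt h1)
    have : σ * Φ.κ⁻¹ ≠ 0 := mul_ne_zero hσ (inv_ne_zero Φ.κ_pos.ne')
    exact absurd hc1 (mul_ne_zero this hf.ne')

/-! ## The two corners of the symmetric union and the reparametrisation of `A` -/

/-- **The upper corner** (height `1`, turning upwards into the edge), in the angle `θ` of the
symmetric union. [folklore] -/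
def cUpN (θ : ℝ) : 𝔼 2 := Φ.corner 1 1 θ

/-- **The lower corner** (height `0`, turning downwards into the edge), read backwards from `π`.
[folklore] -/
def cLoN (θ : ℝ) : 𝔼 2 := Φ.corner 0 (-1) (π - θ)

/-- The offset of the upper affine reading of `A`: `band (0, 1 + κ⁻¹ (θ - t₁)) = A (θ + cup)`.
[folklore] -/
def cup : ℝ := Φ.θaff 1 - Φ.t1

/-- The mismatch `Δ = π + 2 t₁ - κ > 0` of the two affine readings of `A`. [folklore] -/
def Δ : ℝ := π + 2 * Φ.t1 - Φ.κ

/-- `Δ > 0`. [folklore] -/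
theorem Δ_pos : 0 < Φ.Δ := by
  unfold Δ; linarith [Φ.t1_pos, Φ.κ_le_one, Real.pi_gt_three]

/-- Start `b₁ = 1/4 + κ/2` of the blending window of the reparametrisation. [folklore] -/
def b1 : ℝ := 4⁻¹ + Φ.κ / 2

/-- End `b₂ = π - 1/4 - κ/2` of the blending window. [folklore] -/
def b2 : ℝ := π - 4⁻¹ - Φ.κ / 2

/-- `b₁ < b₂`. [folklore] -/
theorem b1_lt_b2 : Φ.b1 < Φ.b2 := by
  unfold b1 b2; linarith [Φ.κ_le_one, Real.pi_gt_three]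

/-- The switch angle `θsw = 1/4 + κ/4` between the corner formula and the `A` formula. [folklore] -/
def θsw : ℝ := 4⁻¹ + Φ.κ / 4

/-- `1/4 < θsw`. [folklore] -/
theorem quarter_lt_θsw : 4⁻¹ < Φ.θsw := by unfold θsw; linarith [Φ.κ_pos]

/-- `θsw < b₁`. [folklore] -/
theorem θsw_lt_b1 : Φ.θsw < Φ.b1 := by unfold θsw b1; linarith [Φ.κ_pos]

/-- `b₁ < t₁ + κ` (the affine edge reading is valid on the whole overlap). [folklore] -/
theorem b1_lt_t1_add_κ : Φ.b1 < Φ.t1 + Φ.κ := by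
  have h1 := Φ.quarter_sub_t1
  have h2 := Φ.ws_le
  have h3 := Φ.κ_mul_δs_le
  have h4 : Φ.κ * Φ.δs ≤ Φ.κ * 2⁻¹ := mul_le_mul_of_nonneg_left Φ.δs_le_half Φ.κ_pos.le
  unfold b1; nlinarith [Φ.κ_pos]

/-- `θsw ≤ 1/2`. [folklore] -/
theorem θsw_le_half : Φ.θsw ≤ 2⁻¹ := by unfold θsw; linarith [Φ.κ_le_one]

/-- `b₂ < π - θsw`. [folklore] -/
theorem b2_lt_pi_sub_θsw : Φ.b2 < π - Φ.θsw := by unfold b2 θsw; linarith [Φ.κ_pos]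

/-- **The reparametrisation of `A`**: `τ θ = θ + cup + Δ · smoothStep b₁ b₂ θ`, slope `1` off the
blending window, slope `≥ 1` on it. [folklore] -/
def τ (θ : ℝ) : ℝ := θ + Φ.cup + Φ.Δ * smoothStep Φ.b1 Φ.b2 θ

/-- `τ` is smooth. [folklore] -/
theorem contDiff_τ : ContDiff ℝ ∞ Φ.τ := by
  unfold τ
  exact (contDiff_id.add contDiff_const).add (contDiff_const.mul (contDiff_smoothStep _ _))

/-- The derivative of `τ`. [folklore] -/
theorem hasDerivAt_τ (θ : ℝ) : HasDerivAt Φ.τ (1 + Φ.Δ * deriv (smoothStep Φ.b1 Φ.b2) θ) θ := by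
  unfold τ
  have h1 : HasDerivAt (fun θ ↦ θ + Φ.cup) 1 θ := (hasDerivAt_id θ).add_const _
  have h2 : HasDerivAt (fun θ ↦ Φ.Δ * smoothStep Φ.b1 Φ.b2 θ) (Φ.Δ * deriv (smoothStep Φ.b1 Φ.b2) θ) θ :=
    ((differentiable_smoothStep _ _ θ).hasDerivAt).const_mul _
  exact h1.add h2

/-- `τ' ≥ 1`. [folklore] -/
theorem one_le_deriv_τ (θ : ℝ) : 1 ≤ deriv Φ.τ θ := by
  rw [(Φ.hasDerivAt_τ θ).deriv]
  have := mul_nonneg Φ.Δ_pos.le (deriv_smoothStep_nonneg Φ.b1_lt_b2 θ)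
  linarith

/-- `τ' ≠ 0`. [folklore] -/
theorem deriv_τ_ne_zero (θ : ℝ) : deriv Φ.τ θ ≠ 0 := by linarith [Φ.one_le_deriv_τ θ]

/-- `τ` is strictly increasing. [folklore] -/
theorem strictMono_τ : StrictMono Φ.τ :=
  strictMono_of_deriv_pos fun θ ↦ by linarith [Φ.one_le_deriv_τ θ]

/-- Left of the window, `τ θ = θ + cup`. [folklore] -/
theorem τ_of_le {θ : ℝ} (h : θ ≤ Φ.b1) : Φ.τ θ = θ + Φ.cup := by
  rw [τ, smoothStep_of_le Φ.b1_lt_b2 h]; ring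

/-- Right of the window, `τ θ = θ + cup + Δ`. [folklore] -/
theorem τ_of_ge {θ : ℝ} (h : Φ.b2 ≤ θ) : Φ.τ θ = θ + Φ.cup + Φ.Δ := by
  rw [τ, smoothStep_of_ge Φ.b1_lt_b2 h]; ring

/-- `θaff` shifts affinely: `θaff (h + y) = θaff h + κ y`. [folklore] -/
theorem θaff_add (h y : ℝ) : Φ.θaff (h + y) = Φ.θaff h + Φ.κ * y := by
  unfold θaff; ring

/-- **The vertical part of the upper corner is `A`**: for `θ ∈ [1/4, t₁ + κ)`,
`band (cUpN θ) = A (θ + cup)`. [folklore] -/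
theorem band_cUpN_of_mem {θ : ℝ} (hθ : θ ∈ Ico 4⁻¹ (Φ.t1 + Φ.κ)) :
    Φ.band (Φ.cUpN θ) = Φ.A (circlePoint (θ + Φ.cup)) := by
  have hκ := Φ.κ_pos
  have ht := Φ.t1_lt
  rw [cUpN, Φ.corner_of_ge hθ.1]
  have hlt : Φ.κ⁻¹ * (θ - Φ.t1) < 1 := by
    rw [inv_mul_lt_iff₀ hκ]; linarith [hθ.2]
  have hge : 0 ≤ Φ.κ⁻¹ * (θ - Φ.t1) := mul_nonneg (inv_nonneg.2 hκ.le) (by linarith [hθ.1])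
  have hmem : 1 + 1 * Φ.κ⁻¹ * (θ - Φ.t1) ∈ Ioo (-1 : ℝ) 2 := by
    constructor <;> nlinarith
  rw [Φ.band_pt2_zero hmem, show 1 * Φ.κ⁻¹ * (θ - Φ.t1) = Φ.κ⁻¹ * (θ - Φ.t1) by ring, θaff_add,
    mul_inv_cancel_left₀ hκ.ne', cup]
  congr 2; ring

/-- **The vertical part of the lower corner is `A`**: for `π - θ ∈ [1/4, t₁ + κ)`,
`band (cLoN θ) = A (θ + cup + Δ)` (the other affine reading, one period on). [folklore] -/
theorem band_cLoN_of_mem {θ : ℝ} (hθ : π - θ ∈ Ico 4⁻¹ (Φ.t1 + Φ.κ)) :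
    Φ.band (Φ.cLoN θ) = Φ.A (circlePoint (θ + Φ.cup + Φ.Δ)) := by
  have hκ := Φ.κ_pos
  have ht := Φ.t1_lt
  rw [cLoN, Φ.corner_of_ge hθ.1]
  have hlt : Φ.κ⁻¹ * (π - θ - Φ.t1) < 1 := by
    rw [inv_mul_lt_iff₀ hκ]; linarith [hθ.2]
  have hge : 0 ≤ Φ.κ⁻¹ * (π - θ - Φ.t1) := mul_nonneg (inv_nonneg.2 hκ.le) (by linarith [hθ.1])
  have hmem : 0 + -1 * Φ.κ⁻¹ * (π - θ - Φ.t1) ∈ Ioo (-1 : ℝ) 2 := by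
    constructor <;> nlinarith
  rw [Φ.band_pt2_zero hmem, show -1 * Φ.κ⁻¹ * (π - θ - Φ.t1) = Φ.κ⁻¹ * (-(π - θ - Φ.t1)) by ring,
    θaff_add, mul_inv_cancel_left₀ hκ.ne', ← periodic_circlePoint.sub_eq (θ + Φ.cup + Φ.Δ)]
  congr 2
  have : Φ.θaff 0 = Φ.θaff 1 - Φ.κ := by unfold θaff; ring
  rw [this, cup, Δ]; ring

/-! ## The northern half-curve and the symmetric curve -/

/-- **The northern half of the symmetric union** (for `θ ∈ [0, π]`): the upper corner, then `A`
reparametrised by `τ`, then the lower corner. [folklore] -/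
def γNS (θ : ℝ) : 𝕊 3 :=
  if θ < Φ.θsw then Φ.band (Φ.cUpN θ)
  else if θ < π - Φ.θsw then Φ.A (circlePoint (Φ.τ θ))
  else Φ.band (Φ.cLoN θ)

/-- On `(-∞, b₁]` the northern half-curve is the band over the upper corner. [folklore] -/
theorem γNS_of_le_b1 {θ : ℝ} (h : θ ≤ Φ.b1) : Φ.γNS θ = Φ.band (Φ.cUpN θ) := by
  unfold γNS
  split_ifs with h1 h2
  · rfl
  · rw [Φ.τ_of_le h, Φ.band_cUpN_of_mem ⟨by linarith [Φ.quarter_lt_θsw], by linarith [Φ.b1_lt_t1_add_κ]⟩]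
  · exfalso; linarith [Φ.b2_lt_pi_sub_θsw, Φ.b1_lt_b2]

/-- On `[1/4, π - 1/4]` the northern half-curve is `A ∘ τ`. [folklore] -/
theorem γNS_of_mem_Icc {θ : ℝ} (h : θ ∈ Icc 4⁻¹ (π - 4⁻¹)) : Φ.γNS θ = Φ.A (circlePoint (Φ.τ θ)) := by
  unfold γNS
  have h3 := Φ.θsw_lt_b1
  have h4 := Φ.b1_lt_t1_add_κ
  have h5 := Φ.b2_lt_pi_sub_θsw
  split_ifs with h1 h2
  · rw [Φ.τ_of_le (by linarith), Φ.band_cUpN_of_mem ⟨h.1, by linarith⟩]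
  · rfl
  · push Not at h2
    rw [Φ.τ_of_ge (by linarith), Φ.band_cLoN_of_mem ⟨by linarith [h.2], by unfold θsw b1 at *; linarith⟩]

/-- On `[b₂, ∞)` the northern half-curve is the band over the lower corner. [folklore] -/
theorem γNS_of_ge_b2 {θ : ℝ} (h : Φ.b2 ≤ θ) : Φ.γNS θ = Φ.band (Φ.cLoN θ) := by
  unfold γNS
  have h3 := Φ.θsw_lt_b1
  have h4 := Φ.b1_lt_t1_add_κ
  have h5 := Φ.b1_lt_b2
  split_ifs with h1 h2
  · exfalso; linarith
  · rw [Φ.τ_of_ge h, Φ.band_cLoN_of_mem ⟨by linarith [Φ.quarter_lt_θsw], by unfold θsw b1 b2 at *; linarith⟩]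
  · rfl

/-- **The symmetric curve on one period** `(-π, π]`: the northern half for `s ≥ 0`, its reflection
for `s < 0`. [folklore] -/
def GS (s : ℝ) : 𝕊 3 := if 0 ≤ s then Φ.γNS s else reflectLast 3 (Φ.γNS (-s))

/-- The reduction of the angle into the period `(-π, π]`. [folklore] -/
def red (θ : ℝ) : ℝ := toIocMod Real.two_pi_pos (-π) θ

/-- **The symmetric union as a `2π`-periodic curve on `𝕊³`.** [folklore] -/
def γS (θ : ℝ) : 𝕊 3 := Φ.GS (red θ)

/-- **The symmetric union as a curve in `ℝ⁴`.** [folklore] -/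
def symCurve (θ : ℝ) : 𝔼 4 := ((Φ.γS θ : 𝕊 3) : 𝔼 4)

/-! ### The reduced angle -/

/-- The reduced angle lies in `(-π, π]`. [folklore] -/
theorem red_mem (θ : ℝ) : red θ ∈ Ioc (-π) π := by
  have := toIocMod_mem_Ioc Real.two_pi_pos (-π) θ
  rwa [show -π + 2 * π = π by ring] at this

/-- The reduced angle differs from the angle by a multiple of `2π`. [folklore] -/
theorem exists_red_eq (θ : ℝ) : ∃ n : ℤ, red θ = θ - n * (2 * π) := by
  obtain ⟨-, z, hz⟩ := (toIocMod_eq_iff Real.two_pi_pos).1 (rfl : toIocMod Real.two_pi_pos (-π) θ = red θ)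
  exact ⟨z, by rw [zsmul_eq_mul] at hz; rw [red]; linarith⟩

/-- Characterisation of the reduced angle. [folklore] -/
theorem red_eq_of_mem {θ : ℝ} {n : ℤ} (h : θ - n * (2 * π) ∈ Ioc (-π) π) : red θ = θ - n * (2 * π) := by
  refine (toIocMod_eq_iff Real.two_pi_pos).2 ⟨by rwa [show -π + 2 * π = π by ring], n, ?_⟩
  rw [zsmul_eq_mul]; ring

/-- Two angles have the same reduction iff they differ by a multiple of `2π`. [folklore] -/
theorem red_eq_red_iff {s t : ℝ} : red s = red t ↔ ∃ n : ℤ, t - s = n * (2 * π) := by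
  rw [red, red, toIocMod_eq_toIocMod]
  simp only [zsmul_eq_mul]

/-- `red` is `2π`-periodic. [folklore] -/
theorem red_add_two_pi (θ : ℝ) : red (θ + 2 * π) = red θ := toIocMod_add_right _ _ _

/-- The symmetric curve is `2π`-periodic. [folklore] -/
theorem periodic_symCurve : Periodic Φ.symCurve (2 * π) := fun θ ↦ by
  simp only [symCurve, γS, red_add_two_pi]

/-- The symmetric curve lies on the unit sphere. [folklore] -/
theorem norm_symCurve (θ : ℝ) : ‖Φ.symCurve θ‖ = 1 := by
  simp only [symCurve, norm_eq_of_mem_sphere]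

/-! ### Closed forms near the two equator points -/

/-- `1 ∈ (-1, 2)`. [folklore] -/
theorem one_mem_Ioo : (1 : ℝ) ∈ Ioo (-1 : ℝ) 2 := by norm_num

/-- `0 ∈ (-1, 2)`. [folklore] -/
theorem zero_mem_Ioo : (0 : ℝ) ∈ Ioo (-1 : ℝ) 2 := by norm_num

/-- On the upper plateau `[−, t₁]` (with `cos > 0`) the northern half-curve is the great circle
through `U⁻¹ â₁`. [folklore] -/
theorem coe_γNS_of_le_t1 {s : ℝ} (hs : s ≤ Φ.t1) (hc : 0 < Real.cos s) :
    ((Φ.γNS s : 𝕊 3) : 𝔼 4) = Real.cos s • uvec (Φ.dir 1) + Real.sin s • e3 := by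
  rw [Φ.γNS_of_le_b1 (hs.trans (by linarith [Φ.t1_lt, Φ.θsw_lt_b1, Φ.quarter_lt_θsw])), cUpN,
    Φ.corner_of_le hs, Φ.coe_band_Xr one_mem_Ioo hc]

/-- On the lower plateau `[π - t₁, −)` (with `cos (π - s) > 0`) the northern half-curve is the
great circle through `U⁻¹ â₀`, reached from the north. [folklore] -/
theorem coe_γNS_of_ge {s : ℝ} (hs : π - Φ.t1 ≤ s) (hc : 0 < Real.cos (π - s)) :
    ((Φ.γNS s : 𝕊 3) : 𝔼 4) = -Real.cos s • uvec (Φ.dir 0) + Real.sin s • e3 := by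
  rw [Φ.γNS_of_ge_b2 (le_trans (by unfold b2; linarith [Φ.t1_lt, Φ.κ_pos]) hs), cLoN,
    Φ.corner_of_le (by linarith), Φ.coe_band_Xr zero_mem_Ioo hc, Real.cos_pi_sub, Real.sin_pi_sub]

/-- `cos s > 0` for `|s| < 1/2`. [folklore] -/
theorem cos_pos_of_abs_lt {s : ℝ} (hs : |s| < 2⁻¹) : 0 < Real.cos s :=
  Real.cos_pos_of_mem_Ioo ⟨by linarith [(abs_lt.1 hs).1, Real.pi_gt_three],
    by linarith [(abs_lt.1 hs).2, Real.pi_gt_three]⟩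

/-- **Near the upper equator point the curve is the standard great circle**: for `|s| ≤ t₁`,
`GS s = cos s · U⁻¹ â₁ + sin s · e₃`. [folklore] -/
theorem coe_GS_of_abs_le {s : ℝ} (hs : |s| ≤ Φ.t1) :
    ((Φ.GS s : 𝕊 3) : 𝔼 4) = Real.cos s • uvec (Φ.dir 1) + Real.sin s • e3 := by
  have ht := Φ.t1_lt
  have hc : 0 < Real.cos s := cos_pos_of_abs_lt (by linarith)
  unfold GS
  split_ifs with h0
  · exact Φ.coe_γNS_of_le_t1 (le_trans (le_abs_self s) hs) hc
  · rw [coe_reflectLast_three_eq, Φ.coe_γNS_of_le_t1 (le_trans (neg_le_abs s) hs) (by rwa [Real.cos_neg]),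
      refl4_ray, neg_neg]

/-- **Near the lower equator point the curve is the standard great circle**: for `π - t₁ ≤ |s|`
(and `|s| ≤ π`), `GS s = -cos s · U⁻¹ â₀ + sin s · e₃`. [folklore] -/
theorem coe_GS_of_le_abs {s : ℝ} (hs : π - Φ.t1 ≤ |s|) (hs' : |s| ≤ π + Φ.t1) :
    ((Φ.GS s : 𝕊 3) : 𝔼 4) = -Real.cos s • uvec (Φ.dir 0) + Real.sin s • e3 := by
  have ht := Φ.t1_lt
  unfold GS
  split_ifs with h0
  · rw [abs_of_nonneg h0] at hs hs'
    exact Φ.coe_γNS_of_ge hs (cos_pos_of_abs_lt (abs_lt.2 ⟨by linarith, by linarith⟩))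
  · push Not at h0
    rw [abs_of_neg h0] at hs hs'
    rw [coe_reflectLast_three_eq, Φ.coe_γNS_of_ge (by linarith)
      (cos_pos_of_abs_lt (abs_lt.2 ⟨by linarith, by linarith⟩))]
    simp only [map_add, map_neg, map_smul, refl4_uvec, refl4_e3, Real.cos_neg, Real.sin_neg, smul_neg,
      neg_smul, neg_neg]

/-! ### Smoothness of the northern half-curve on `(-1/2, π + 1/2)` -/

/-- The upper corner is smooth on `(-1/2, ∞)`. [folklore] -/
theorem contDiffAt_cUpN {θ : ℝ} (h : -2⁻¹ < θ) : ContDiffAt ℝ ∞ Φ.cUpN θ := Φ.contDiffAt_corner 1 1 h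

/-- The lower corner is smooth on `(-∞, π + 1/2)`. [folklore] -/
theorem contDiffAt_cLoN {θ : ℝ} (h : θ < π + 2⁻¹) : ContDiffAt ℝ ∞ Φ.cLoN θ := by
  unfold cLoN
  exact (Φ.contDiffAt_corner 0 (-1) (s := π - θ) (by linarith)).comp θ
    (contDiff_const.sub contDiff_id).contDiffAt

/-- The band over a planar curve, read in `ℝ⁴`, is smooth where the curve is. [folklore] -/
theorem contDiffAt_coe_band_comp {c : ℝ → 𝔼 2} {θ : ℝ} (hc : ContDiffAt ℝ ∞ c θ) :
    ContDiffAt ℝ ∞ (fun t ↦ ((Φ.band (c t) : 𝕊 3) : 𝔼 4)) θ :=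
  Φ.contDiff_coe_band.contDiffAt.comp θ hc

/-- `A ∘ τ`, read in `ℝ⁴`, is smooth. [folklore] -/
theorem contDiff_curve_τ : ContDiff ℝ ∞ fun t ↦ SphereEmbedding.curve Φ.A (Φ.τ t) :=
  (SphereEmbedding.contDiff_curve Φ.A).comp Φ.contDiff_τ

/-- **Local representations of the northern half-curve**: near every `θ ∈ (-1/2, π + 1/2)` it is
the band over the upper corner, or `A ∘ τ`, or the band over the lower corner. [folklore] -/
theorem exists_local_rep_γNS (θ₀ : ℝ) :
    (θ₀ < Φ.b1 ∧ (fun θ ↦ ((Φ.γNS θ : 𝕊 3) : 𝔼 4)) =ᶠ[𝓝 θ₀] fun θ ↦ ((Φ.band (Φ.cUpN θ) : 𝕊 3) : 𝔼 4)) ∨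
    (θ₀ ∈ Ioo 4⁻¹ (π - 4⁻¹) ∧
      (fun θ ↦ ((Φ.γNS θ : 𝕊 3) : 𝔼 4)) =ᶠ[𝓝 θ₀] fun θ ↦ SphereEmbedding.curve Φ.A (Φ.τ θ)) ∨
    (Φ.b2 < θ₀ ∧ (fun θ ↦ ((Φ.γNS θ : 𝕊 3) : 𝔼 4)) =ᶠ[𝓝 θ₀] fun θ ↦ ((Φ.band (Φ.cLoN θ) : 𝕊 3) : 𝔼 4)) := by
  have h3 := Φ.θsw_lt_b1
  have h4 := Φ.quarter_lt_θsw
  have h5 := Φ.b2_lt_pi_sub_θsw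
  have h6 := Φ.b1_lt_b2
  rcases lt_or_ge θ₀ Φ.θsw with ha | ha
  · left
    refine ⟨by linarith, ?_⟩
    filter_upwards [Iio_mem_nhds (show θ₀ < Φ.b1 by linarith)] with θ hθ
    rw [Φ.γNS_of_le_b1 (le_of_lt hθ)]
  rcases le_or_gt θ₀ (π - Φ.θsw) with hb | hb
  · right; left
    refine ⟨⟨by linarith, by linarith⟩, ?_⟩
    filter_upwards [Ioo_mem_nhds (show (4⁻¹ : ℝ) < θ₀ by linarith) (show θ₀ < π - 4⁻¹ by linarith)]
      with θ hθ
    rw [Φ.γNS_of_mem_Icc ⟨hθ.1.le, hθ.2.le⟩, SphereEmbedding.curve_apply]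
  · right; right
    refine ⟨by linarith, ?_⟩
    filter_upwards [Ioi_mem_nhds (show Φ.b2 < θ₀ by linarith)] with θ hθ
    rw [Φ.γNS_of_ge_b2 (le_of_lt hθ)]

/-- **The northern half-curve is smooth on `(-1/2, π + 1/2)`**, read in `ℝ⁴`. [folklore] -/
theorem contDiffAt_coe_γNS {θ₀ : ℝ} (h₁ : -2⁻¹ < θ₀) (h₂ : θ₀ < π + 2⁻¹) :
    ContDiffAt ℝ ∞ (fun θ ↦ ((Φ.γNS θ : 𝕊 3) : 𝔼 4)) θ₀ := by
  rcases Φ.exists_local_rep_γNS θ₀ with ⟨-, h⟩ | ⟨-, h⟩ | ⟨-, h⟩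
  · exact (Φ.contDiffAt_coe_band_comp (Φ.contDiffAt_cUpN h₁)).congr_of_eventuallyEq h
  · exact Φ.contDiff_curve_τ.contDiffAt.congr_of_eventuallyEq h
  · exact (Φ.contDiffAt_coe_band_comp (Φ.contDiffAt_cLoN h₂)).congr_of_eventuallyEq h

/-! ### Regularity of the northern half-curve on `(-1/2, π + 1/2)` -/

/-- The differential of the band read in `ℝ⁴` is injective on the collar strip. [folklore] -/
theorem injective_fderiv_coe_band {x : 𝔼 2} (hx : x 1 ∈ Ioo (-1 : ℝ) 2) :
    Injective (fderiv ℝ (fun y ↦ ((Φ.band y : 𝕊 3) : 𝔼 4)) x) := by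
  rw [Φ.fderiv_coe_band, ContinuousLinearMap.coe_comp]
  exact (injective_fderiv_phi _).comp (Φ.injective_DbandChart hx)

/-- The velocity of the band over a regular planar curve in the strip is nonzero. [folklore] -/
theorem deriv_coe_band_comp_ne_zero {c : ℝ → 𝔼 2} {θ : ℝ} (hc : DifferentiableAt ℝ c θ)
    (hU : c θ 1 ∈ Ioo (-1 : ℝ) 2) (hc' : deriv c θ ≠ 0) :
    deriv (fun t ↦ ((Φ.band (c t) : 𝕊 3) : 𝔼 4)) θ ≠ 0 := by
  have hd : HasDerivAt (fun t ↦ ((Φ.band (c t) : 𝕊 3) : 𝔼 4))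
      (fderiv ℝ (fun x ↦ ((Φ.band x : 𝕊 3) : 𝔼 4)) (c θ) (deriv c θ)) θ :=
    (Φ.differentiable_coe_band (c θ)).hasFDerivAt.comp_hasDerivAt θ hc.hasDerivAt
  rw [hd.deriv]
  intro h0
  exact hc' (Φ.injective_fderiv_coe_band hU (by rw [h0, map_zero]))

/-- Heights of the upper corner lie in `[1, 2)` for `θ < t₁ + κ`. [folklore] -/
theorem cUpN_apply_one_mem {θ : ℝ} (hθ : θ < Φ.t1 + Φ.κ) : Φ.cUpN θ 1 ∈ Ico (1 : ℝ) 2 := by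
  have hκ := Φ.κ_pos
  rw [cUpN, corner_apply_one]
  rcases le_or_gt θ Φ.t1 with h | h
  · rw [Φ.χ_of_le h]; norm_num
  · have hχ := Φ.χ_mem θ
    have h1 : 0 ≤ 1 * Φ.κ⁻¹ * (θ - Φ.t1) * Φ.χ θ :=
      mul_nonneg (mul_nonneg (by positivity) (by linarith)) hχ.1
    have h2 : 1 * Φ.κ⁻¹ * (θ - Φ.t1) * Φ.χ θ < 1 := by
      have h3 : Φ.κ⁻¹ * (θ - Φ.t1) < 1 := by rw [inv_mul_lt_iff₀ hκ]; linarith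
      calc 1 * Φ.κ⁻¹ * (θ - Φ.t1) * Φ.χ θ ≤ 1 * Φ.κ⁻¹ * (θ - Φ.t1) * 1 :=
            mul_le_mul_of_nonneg_left hχ.2 (mul_nonneg (by positivity) (by linarith))
        _ < 1 := by linarith
    constructor <;> linarith

/-- Heights of the lower corner lie in `(-1, 0]` for `π - θ < t₁ + κ`. [folklore] -/
theorem cLoN_apply_one_mem {θ : ℝ} (hθ : π - θ < Φ.t1 + Φ.κ) : Φ.cLoN θ 1 ∈ Ioc (-1 : ℝ) 0 := by
  have hκ := Φ.κ_pos
  rw [cLoN, corner_apply_one]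
  rcases le_or_gt (π - θ) Φ.t1 with h | h
  · rw [Φ.χ_of_le h]; norm_num
  · have hχ := Φ.χ_mem (π - θ)
    have h1 : 0 ≤ Φ.κ⁻¹ * (π - θ - Φ.t1) * Φ.χ (π - θ) :=
      mul_nonneg (mul_nonneg (by positivity) (by linarith)) hχ.1
    have h2 : Φ.κ⁻¹ * (π - θ - Φ.t1) * Φ.χ (π - θ) < 1 := by
      have h3 : Φ.κ⁻¹ * (π - θ - Φ.t1) < 1 := by rw [inv_mul_lt_iff₀ hκ]; linarith
      calc Φ.κ⁻¹ * (π - θ - Φ.t1) * Φ.χ (π - θ) ≤ Φ.κ⁻¹ * (π - θ - Φ.t1) * 1 :=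
            mul_le_mul_of_nonneg_left hχ.2 (mul_nonneg (by positivity) (by linarith))
        _ < 1 := by linarith
    constructor <;> nlinarith

/-- `b₁ < t₁ + κ` in the form used for heights. [folklore] -/
theorem lt_t1_add_κ_of_lt_b1 {θ : ℝ} (h : θ < Φ.b1) : θ < Φ.t1 + Φ.κ := h.trans Φ.b1_lt_t1_add_κ

/-- The derivative of the lower corner. [folklore] -/
theorem deriv_cLoN (θ : ℝ) (h : θ < π + 2⁻¹) : deriv Φ.cLoN θ = -deriv (Φ.corner 0 (-1)) (π - θ) := by
  have hd : HasDerivAt (Φ.corner 0 (-1)) (deriv (Φ.corner 0 (-1)) (π - θ)) (π - θ) :=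
    ((Φ.contDiffAt_corner 0 (-1) (by linarith)).differentiableAt (by simp)).hasDerivAt
  have h2 : HasDerivAt (fun θ : ℝ ↦ π - θ) (-1) θ := by simpa using (hasDerivAt_id θ).const_sub π
  have := hd.scomp θ h2
  rw [show Φ.cLoN = Φ.corner 0 (-1) ∘ fun θ ↦ π - θ from rfl, this.deriv]
  simp

/-- **The northern half-curve is regular on `(-1/2, π + 1/2)`.** [folklore] -/
theorem deriv_coe_γNS_ne_zero {θ₀ : ℝ} (h₁ : -2⁻¹ < θ₀) (h₂ : θ₀ < π + 2⁻¹) :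
    deriv (fun θ ↦ ((Φ.γNS θ : 𝕊 3) : 𝔼 4)) θ₀ ≠ 0 := by
  rcases Φ.exists_local_rep_γNS θ₀ with ⟨hb, h⟩ | ⟨-, h⟩ | ⟨hb, h⟩
  · rw [h.deriv_eq]
    exact Φ.deriv_coe_band_comp_ne_zero ((Φ.contDiffAt_cUpN h₁).differentiableAt (by simp))
      (let hm := Φ.cUpN_apply_one_mem (Φ.lt_t1_add_κ_of_lt_b1 hb); ⟨by linarith [hm.1], hm.2⟩)
      (Φ.deriv_corner_ne_zero one_mem_Ioo one_ne_zero h₁)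
  · rw [h.deriv_eq]
    have hd : HasDerivAt (fun θ ↦ SphereEmbedding.curve Φ.A (Φ.τ θ))
        (deriv Φ.τ θ₀ • SphereEmbedding.tangent Φ.A (Φ.τ θ₀)) θ₀ :=
      (SphereEmbedding.hasDerivAt_curve Φ.A (Φ.τ θ₀)).scomp θ₀
        ((Φ.contDiff_τ.differentiable (by simp)) θ₀).hasDerivAt
    rw [hd.deriv]
    exact smul_ne_zero (Φ.deriv_τ_ne_zero θ₀) (SphereEmbedding.tangent_ne_zero Φ.A _)
  · rw [h.deriv_eq]
    have hb' : π - θ₀ < Φ.t1 + Φ.κ := by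
      have := Φ.b1_lt_t1_add_κ; unfold b1 b2 at *; linarith
    refine Φ.deriv_coe_band_comp_ne_zero ((Φ.contDiffAt_cLoN h₂).differentiableAt (by simp))
      (let hm := Φ.cLoN_apply_one_mem hb'; ⟨hm.1, by linarith [hm.2]⟩) ?_
    rw [Φ.deriv_cLoN θ₀ h₂, neg_ne_zero]
    exact Φ.deriv_corner_ne_zero zero_mem_Ioo (by norm_num) (by linarith)

/-! ### Local representations, smoothness and regularity of the symmetric curve -/

/-- Near the upper equator point: if `θ - m · 2π ∈ (-t₁, t₁)` then
`symCurve θ = cos θ · U⁻¹ â₁ + sin θ · e₃`. [folklore] -/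
theorem symCurve_of_near_zero {θ : ℝ} {m : ℤ} (h : θ - m * (2 * π) ∈ Ioo (-Φ.t1) Φ.t1) :
    Φ.symCurve θ = Real.cos θ • uvec (Φ.dir 1) + Real.sin θ • e3 := by
  have ht := Φ.t1_lt
  have hred : red θ = θ - m * (2 * π) :=
    red_eq_of_mem ⟨by linarith [h.1, Real.pi_gt_three], by linarith [h.2, Real.pi_gt_three]⟩
  rw [symCurve, γS, hred, Φ.coe_GS_of_abs_le (abs_le.2 ⟨h.1.le, h.2.le⟩), Real.cos_sub_int_mul_two_pi,
    Real.sin_sub_int_mul_two_pi]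

/-- Near the lower equator point: if `θ - m · 2π ∈ (π - t₁, π + t₁)` then
`symCurve θ = -cos θ · U⁻¹ â₀ + sin θ · e₃`. [folklore] -/
theorem symCurve_of_near_pi {θ : ℝ} {m : ℤ} (h : θ - m * (2 * π) ∈ Ioo (π - Φ.t1) (π + Φ.t1)) :
    Φ.symCurve θ = -Real.cos θ • uvec (Φ.dir 0) + Real.sin θ • e3 := by
  have ht := Φ.t1_lt
  have hpos : 0 < θ - m * (2 * π) := by linarith [h.1, Real.pi_gt_three]
  rcases le_or_gt (θ - m * (2 * π)) π with h1 | h1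
  · have hred : red θ = θ - m * (2 * π) := red_eq_of_mem ⟨by linarith [Real.pi_pos], h1⟩
    have ha : π - Φ.t1 ≤ |θ - m * (2 * π)| := by rw [abs_of_pos hpos]; exact h.1.le
    have hb : |θ - m * (2 * π)| ≤ π + Φ.t1 := by rw [abs_of_pos hpos]; linarith [h.2]
    rw [symCurve, γS, hred, Φ.coe_GS_of_le_abs ha hb, Real.cos_sub_int_mul_two_pi, Real.sin_sub_int_mul_two_pi]
  · have hred : red θ = θ - (m + 1 : ℤ) * (2 * π) :=
      red_eq_of_mem ⟨by push_cast; linarith, by push_cast; linarith [h.2, Real.pi_gt_three]⟩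
    have hneg : θ - (m + 1 : ℤ) * (2 * π) < 0 := by push_cast; linarith [h.2, Real.pi_gt_three]
    have ha : π - Φ.t1 ≤ |θ - (m + 1 : ℤ) * (2 * π)| := by rw [abs_of_neg hneg]; push_cast; linarith [h.2]
    have hb : |θ - (m + 1 : ℤ) * (2 * π)| ≤ π + Φ.t1 := by
      rw [abs_of_neg hneg]; push_cast; linarith [h.1, h.2]
    rw [symCurve, γS, hred, Φ.coe_GS_of_le_abs ha hb, Real.cos_sub_int_mul_two_pi, Real.sin_sub_int_mul_two_pi]

/-- In the open northern half: if `θ - n · 2π ∈ (0, π)` then `symCurve θ = γN (θ - n · 2π)`.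
[folklore] -/
theorem symCurve_of_mem_north {θ : ℝ} {n : ℤ} (h : θ - n * (2 * π) ∈ Ioo 0 π) :
    Φ.symCurve θ = ((Φ.γNS (θ - n * (2 * π)) : 𝕊 3) : 𝔼 4) := by
  rw [symCurve, γS, red_eq_of_mem ⟨by linarith [h.1, Real.pi_pos], h.2.le⟩, GS, if_pos h.1.le]

/-- In the open southern half: if `θ - n · 2π ∈ (-π, 0)` then `symCurve θ = R (γN (-(θ - n · 2π)))`.
[folklore] -/
theorem symCurve_of_mem_south {θ : ℝ} {n : ℤ} (h : θ - n * (2 * π) ∈ Ioo (-π) 0) :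
    Φ.symCurve θ = refl4 ((Φ.γNS (-(θ - n * (2 * π))) : 𝕊 3) : 𝔼 4) := by
  rw [symCurve, γS, red_eq_of_mem ⟨h.1, by linarith [h.2, Real.pi_pos]⟩, GS, if_neg (not_le.2 h.2),
    coe_reflectLast_three_eq]

/-- **Local representations of the symmetric curve**: near every angle it is one of the two great
circles, or a translate of the northern half-curve, or the reflection of one. [folklore] -/
theorem exists_local_rep_symCurve (θ₀ : ℝ) :
    (|red θ₀| < Φ.t1 ∧ Φ.symCurve =ᶠ[𝓝 θ₀] fun θ ↦ Real.cos θ • uvec (Φ.dir 1) + Real.sin θ • e3) ∨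
    (π - Φ.t1 < |red θ₀| ∧ Φ.symCurve =ᶠ[𝓝 θ₀] fun θ ↦ -Real.cos θ • uvec (Φ.dir 0) + Real.sin θ • e3) ∨
    (∃ n : ℤ, θ₀ - n * (2 * π) ∈ Ioo 0 π ∧
      Φ.symCurve =ᶠ[𝓝 θ₀] fun θ ↦ ((Φ.γNS (θ - n * (2 * π)) : 𝕊 3) : 𝔼 4)) ∨
    (∃ n : ℤ, θ₀ - n * (2 * π) ∈ Ioo (-π) 0 ∧
      Φ.symCurve =ᶠ[𝓝 θ₀] fun θ ↦ refl4 ((Φ.γNS (-(θ - n * (2 * π))) : 𝕊 3) : 𝔼 4)) := by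
  have ht := Φ.t1_pos
  have ht' := Φ.t1_lt
  obtain ⟨n, hn⟩ := exists_red_eq θ₀
  have hr := red_mem θ₀
  rw [hn] at hr
  -- near the upper equator point
  by_cases h0 : |θ₀ - n * (2 * π)| < Φ.t1
  · left
    refine ⟨by rwa [hn], ?_⟩
    have hwin : Ioo (n * (2 * π) - Φ.t1) (n * (2 * π) + Φ.t1) ∈ 𝓝 θ₀ :=
      Ioo_mem_nhds (by linarith [(abs_lt.1 h0).1]) (by linarith [(abs_lt.1 h0).2])
    filter_upwards [hwin] with θ hθ
    exact Φ.symCurve_of_near_zero (m := n) ⟨by linarith [hθ.1], by linarith [hθ.2]⟩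
  -- near the lower equator point
  by_cases hπ : π - Φ.t1 < |θ₀ - n * (2 * π)|
  · right; left
    refine ⟨by rwa [hn], ?_⟩
    rcases le_or_gt 0 (θ₀ - n * (2 * π)) with hs | hs
    · rw [abs_of_nonneg hs] at hπ
      have hwin : Ioo (n * (2 * π) + π - Φ.t1) (n * (2 * π) + π + Φ.t1) ∈ 𝓝 θ₀ :=
        Ioo_mem_nhds (by linarith) (by linarith [hr.2])
      filter_upwards [hwin] with θ hθ
      exact Φ.symCurve_of_near_pi (m := n) ⟨by linarith [hθ.1], by linarith [hθ.2]⟩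
    · rw [abs_of_neg hs] at hπ
      have hwin : Ioo ((n - 1 : ℤ) * (2 * π) + π - Φ.t1) ((n - 1 : ℤ) * (2 * π) + π + Φ.t1) ∈ 𝓝 θ₀ :=
        Ioo_mem_nhds (by push_cast; linarith [hr.1]) (by push_cast; linarith)
      filter_upwards [hwin] with θ hθ
      exact Φ.symCurve_of_near_pi (m := n - 1) ⟨by linarith [hθ.1], by linarith [hθ.2]⟩
  push Not at h0 hπ
  -- generic points of the two open halves
  rcases lt_or_gt_of_ne (show θ₀ - n * (2 * π) ≠ 0 from fun h ↦ by
    rw [h, abs_zero] at h0; linarith) with hs | hs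
  · -- southern half
    right; right; right
    rw [abs_of_neg hs] at h0 hπ
    refine ⟨n, ⟨hr.1, hs⟩, ?_⟩
    have hwin : Ioo (n * (2 * π) - π) (n * (2 * π)) ∈ 𝓝 θ₀ := Ioo_mem_nhds (by linarith [hr.1]) (by linarith)
    filter_upwards [hwin] with θ hθ
    exact Φ.symCurve_of_mem_south ⟨by linarith [hθ.1], by linarith [hθ.2]⟩
  · -- northern half
    right; right; left
    rw [abs_of_pos hs] at h0 hπ
    have hlt : θ₀ - n * (2 * π) < π := lt_of_le_of_ne hr.2 fun h ↦ by rw [h] at hπ; linarith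
    refine ⟨n, ⟨hs, hlt⟩, ?_⟩
    have hwin : Ioo (n * (2 * π)) (n * (2 * π) + π) ∈ 𝓝 θ₀ := Ioo_mem_nhds (by linarith) (by linarith)
    filter_upwards [hwin] with θ hθ
    exact Φ.symCurve_of_mem_north ⟨by linarith [hθ.1], by linarith [hθ.2]⟩

/-- The great circle through `U⁻¹ a` has the derivative `-sin θ · U⁻¹ a + cos θ · e₃`. [folklore] -/
theorem hasDerivAt_greatCircle (a : 𝔼 3) (c : ℝ) (θ : ℝ) :
    HasDerivAt (fun θ ↦ (c * Real.cos θ) • uvec a + Real.sin θ • e3)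
      ((c * -Real.sin θ) • uvec a + Real.cos θ • e3) θ :=
  (((Real.hasDerivAt_cos θ).const_mul c).smul_const _).add ((Real.hasDerivAt_sin θ).smul_const _)

/-- The last coordinate of `x · U⁻¹ a + y · e₃` is `y`. [folklore] -/
theorem greatCircle_apply_three (a : 𝔼 3) (x y : ℝ) : (x • uvec a + y • e3) 3 = y := by
  simp [uvec_apply_three, e3_apply]

/-- **The symmetric curve is `C^∞`.** [folklore] -/
theorem contDiff_symCurve : ContDiff ℝ ∞ Φ.symCurve := by
  rw [contDiff_iff_contDiffAt]
  intro θ₀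
  have hsh : ∀ n : ℤ, ContDiff ℝ ∞ fun θ : ℝ ↦ θ - n * (2 * π) := fun n ↦ contDiff_id.sub contDiff_const
  rcases Φ.exists_local_rep_symCurve θ₀ with ⟨-, h⟩ | ⟨-, h⟩ | ⟨n, hn, h⟩ | ⟨n, hn, h⟩
  · refine ContDiffAt.congr_of_eventuallyEq ?_ h
    exact ((Real.contDiff_cos.smul contDiff_const).add (Real.contDiff_sin.smul contDiff_const)).contDiffAt
  · refine ContDiffAt.congr_of_eventuallyEq ?_ h
    exact (((Real.contDiff_cos).neg.smul contDiff_const).add (Real.contDiff_sin.smul contDiff_const)).contDiffAt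
  · refine ContDiffAt.congr_of_eventuallyEq ?_ h
    have h1 : ContDiffAt ℝ ∞ ((fun θ ↦ ((Φ.γNS θ : 𝕊 3) : 𝔼 4)) ∘ fun θ : ℝ ↦ θ - n * (2 * π)) θ₀ :=
      ContDiffAt.comp θ₀ (Φ.contDiffAt_coe_γNS (by show -2⁻¹ < θ₀ - n * (2 * π); linarith [hn.1])
        (by show θ₀ - n * (2 * π) < π + 2⁻¹; linarith [hn.2])) (hsh n).contDiffAt
    exact h1
  · refine ContDiffAt.congr_of_eventuallyEq ?_ h
    have h1 : ContDiffAt ℝ ∞ ((fun θ ↦ ((Φ.γNS θ : 𝕊 3) : 𝔼 4)) ∘ fun θ : ℝ ↦ -(θ - n * (2 * π))) θ₀ :=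
      ContDiffAt.comp θ₀ (Φ.contDiffAt_coe_γNS (by show -2⁻¹ < -(θ₀ - n * (2 * π)); linarith [hn.2])
        (by show -(θ₀ - n * (2 * π)) < π + 2⁻¹; linarith [hn.1])) (hsh n).neg.contDiffAt
    exact refl4.contDiff.contDiffAt.comp θ₀ h1

/-- **The symmetric curve is regular.** [folklore] -/
theorem deriv_symCurve_ne_zero (θ₀ : ℝ) : deriv Φ.symCurve θ₀ ≠ 0 := by
  have ht := Φ.t1_lt
  obtain ⟨n₀, hn₀⟩ := exists_red_eq θ₀
  rcases Φ.exists_local_rep_symCurve θ₀ with ⟨hr, h⟩ | ⟨hr, h⟩ | ⟨n, hn, h⟩ | ⟨n, hn, h⟩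
  · rw [h.deriv_eq]
    have hd := hasDerivAt_greatCircle (Φ.dir 1) 1 θ₀
    simp only [one_mul] at hd
    rw [hd.deriv]
    intro h0
    have := congrArg (fun v : 𝔼 4 ↦ v 3) h0
    rw [greatCircle_apply_three] at this
    have hcos : 0 < Real.cos θ₀ := by
      rw [← Real.cos_sub_int_mul_two_pi θ₀ n₀, ← hn₀]
      exact cos_pos_of_abs_lt (by linarith)
    simp at this; linarith
  · rw [h.deriv_eq]
    have hd := hasDerivAt_greatCircle (Φ.dir 0) (-1) θ₀
    simp only [neg_one_mul] at hd
    rw [hd.deriv]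
    intro h0
    have := congrArg (fun v : 𝔼 4 ↦ v 3) h0
    rw [greatCircle_apply_three] at this
    have hcos : Real.cos θ₀ < 0 := by
      rw [← Real.cos_sub_int_mul_two_pi θ₀ n₀, ← hn₀, ← Real.cos_abs]
      have h1 : |red θ₀| ≤ π := by
        have := red_mem θ₀
        exact abs_le.2 ⟨this.1.le, this.2⟩
      have h2 : Real.cos |red θ₀| < Real.cos (π / 2) :=
        Real.cos_lt_cos_of_nonneg_of_le_pi (by linarith [Real.pi_pos]) h1 (by linarith [Real.pi_gt_three])
      rwa [Real.cos_pi_div_two] at h2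
    simp at this; linarith
  · have shift : ∀ (F : ℝ → 𝔼 4) (c : ℝ), DifferentiableAt ℝ F (θ₀ - c) →
        deriv (fun θ ↦ F (θ - c)) θ₀ = deriv F (θ₀ - c) := fun F c hF ↦ by
      have h1 : HasDerivAt (fun θ : ℝ ↦ θ - c) 1 θ₀ := (hasDerivAt_id θ₀).sub_const _
      have h2 : HasDerivAt (fun θ ↦ F (θ - c)) ((1 : ℝ) • deriv F (θ₀ - c)) θ₀ := hF.hasDerivAt.scomp θ₀ h1
      rw [h2.deriv, one_smul]
    have hF := (Φ.contDiffAt_coe_γNS (θ₀ := θ₀ - n * (2 * π)) (by linarith [hn.1])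
      (by linarith [hn.2])).differentiableAt (by simp)
    rw [h.deriv_eq, shift _ _ hF]
    exact Φ.deriv_coe_γNS_ne_zero (by linarith [hn.1]) (by linarith [hn.2])
  · have shiftneg : ∀ (F : ℝ → 𝔼 4) (c : ℝ), DifferentiableAt ℝ F (-(θ₀ - c)) →
        deriv (fun θ ↦ refl4 (F (-(θ - c)))) θ₀ = -refl4 (deriv F (-(θ₀ - c))) := fun F c hF ↦ by
      have h1 : HasDerivAt (fun θ : ℝ ↦ -(θ - c)) (-1) θ₀ := ((hasDerivAt_id θ₀).sub_const _).neg
      have h2 : HasDerivAt (fun θ ↦ F (-(θ - c))) ((-1 : ℝ) • deriv F (-(θ₀ - c))) θ₀ :=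
        hF.hasDerivAt.scomp θ₀ h1
      have h3 : HasDerivAt (fun θ ↦ refl4 (F (-(θ - c)))) (refl4 ((-1 : ℝ) • deriv F (-(θ₀ - c)))) θ₀ :=
        refl4.hasFDerivAt.comp_hasDerivAt θ₀ h2
      rw [h3.deriv, map_smul, neg_one_smul]
    have hF := (Φ.contDiffAt_coe_γNS (θ₀ := -(θ₀ - n * (2 * π))) (by linarith [hn.2])
      (by linarith [hn.1])).differentiableAt (by simp)
    rw [h.deriv_eq, shiftneg _ _ hF, neg_ne_zero]
    intro h0
    have h4 := congrArg refl4 h0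
    rw [refl4_refl4, map_zero] at h4
    exact Φ.deriv_coe_γNS_ne_zero (by linarith [hn.2]) (by linarith [hn.1]) h4

/-- **The symmetric union is a regular closed curve.** [folklore] -/
theorem isRegularClosedCurve_symCurve : IsRegularClosedCurve Φ.symCurve where
  contDiff := Φ.contDiff_symCurve
  periodic := Φ.periodic_symCurve
  norm_eq_one := Φ.norm_symCurve
  deriv_ne_zero := Φ.deriv_symCurve_ne_zero

/-! ## Injectivity modulo the period -/

/-- `A` lies in the open northern hemisphere. [folklore] -/
theorem A_apply_last_pos (x : 𝕊 1) : 0 < ((Φ.A x : 𝕊 3) : 𝔼 4) (Fin.last 3) := by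
  have h : ((Φ.A x : 𝕊 3) : 𝔼 4) = phi (psi (Φ.A x)) := by
    conv_lhs => rw [← psi_symm_apply_psi (Φ.ne_southPole x)]
    rfl
  rw [show (Fin.last 3 : Fin 4) = 3 from rfl, h, phi_apply_three_pos_iff]
  exact Φ.norm_lt_two x

/-- `A` lies in the open northern hemisphere (`InNorth`). [folklore] -/
theorem inNorth_A : SphereEmbedding.InNorth Φ.A := Φ.A_apply_last_pos

/-- The first coordinate of a corner is positive before the edge: `s ∈ [0, 1/4)`. [folklore] -/
theorem corner_fst_pos {h σ s : ℝ} (hh : h ∈ Ioo (-1 : ℝ) 2) (hs : s ∈ Ico (0 : ℝ) 4⁻¹) :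
    0 < Φ.corner h σ s 0 := by
  rw [corner_apply_zero]
  have h2 : 0 < 1 - Φ.χ s := by
    rcases le_or_gt s Φ.t1 with h3 | h3
    · rw [Φ.χ_of_le h3]; norm_num
    · linarith [(Φ.χ_mem_Ioo ⟨h3, hs.2⟩).2]
  exact mul_pos h2 (Φ.Xr_pos hh ⟨hs.1, hs.2.le⟩)

/-- The first coordinate of a corner is at most `1/2` on `[0, ∞)`. [folklore] -/
theorem corner_fst_le_half {h σ s : ℝ} (hh : h ∈ Ioo (-1 : ℝ) 2) (hs : 0 ≤ s) :
    Φ.corner h σ s 0 ≤ 2⁻¹ := by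
  rw [corner_apply_zero]
  rcases lt_or_ge s 4⁻¹ with h1 | h1
  · have hX := Φ.Xr_le_half hh ⟨hs, by linarith⟩
    have hX' := (Φ.Xr_pos hh ⟨hs, h1.le⟩).le
    have hχ := Φ.χ_mem s
    nlinarith [hχ.1, hχ.2]
  · rw [Φ.χ_of_ge h1]; norm_num

/-- The first coordinate of a corner is `< 1/2` on `(0, ∞)`. [folklore] -/
theorem corner_fst_lt_half {h σ s : ℝ} (hh : h ∈ Ioo (-1 : ℝ) 2) (hs : 0 < s) :
    Φ.corner h σ s 0 < 2⁻¹ := by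
  rw [corner_apply_zero]
  rcases lt_or_ge s 4⁻¹ with h1 | h1
  · have hX := Φ.Xr_lt_half hh ⟨hs, by linarith⟩
    have hX' := (Φ.Xr_pos hh ⟨hs.le, h1.le⟩).le
    have hχ := Φ.χ_mem s
    nlinarith [hχ.1, hχ.2]
  · rw [Φ.χ_of_ge h1]; norm_num

/-- The first coordinate of a corner is nonnegative on `[0, ∞)`. [folklore] -/
theorem corner_fst_nonneg {h σ s : ℝ} (hh : h ∈ Ioo (-1 : ℝ) 2) (hs : 0 ≤ s) : 0 ≤ Φ.corner h σ s 0 := by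
  rcases lt_or_ge s 4⁻¹ with h1 | h1
  · exact (Φ.corner_fst_pos (σ := σ) hh ⟨hs, h1⟩).le
  · rw [Φ.corner_of_ge h1, pt2_apply_zero]

/-- **The first coordinate of a corner is strictly decreasing on `[0, 1/4]`.** [folklore] -/
theorem strictAntiOn_corner_fst {h : ℝ} (σ : ℝ) (hh : h ∈ Ioo (-1 : ℝ) 2) :
    StrictAntiOn (fun s ↦ Φ.corner h σ s 0) (Icc 0 4⁻¹) := by
  refine strictAntiOn_of_deriv_neg (convex_Icc _ _) (fun s hs ↦ ?_) fun s hs ↦ ?_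
  · have hc : ContDiffAt ℝ ∞ (fun s ↦ Φ.corner h σ s 0) s := by
      simp only [corner_apply_zero]; exact Φ.contDiffAt_corner_fst h (by linarith [hs.1])
    exact hc.continuousAt.continuousWithinAt
  · rw [interior_Icc] at hs
    exact Φ.deriv_corner_fst_neg hh (cos_pos_of_mem_Icc ⟨hs.1.le, hs.2.le⟩) hs.2 (Φ.Xr_pos hh ⟨hs.1.le, hs.2.le⟩)

/-- The upper corner before the edge lies in the collar square of width `δ`, off the left edge,
in the closed northern half. [folklore] -/
theorem cUpN_mem {s : ℝ} (hs : s ∈ Ico (0 : ℝ) 4⁻¹) :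
    Φ.cUpN s ∈ squareNhd Φ.δs ∧ 0 < Φ.cUpN s 0 ∧ Φ.cUpN s 0 ≤ 2⁻¹ ∧ Φ.cUpN s 1 ∈ Ico (1 : ℝ) (1 + Φ.δs) := by
  have hδ := Φ.δs_pos
  have hκ := Φ.κ_pos
  have h0 : 0 < Φ.cUpN s 0 := Φ.corner_fst_pos one_mem_Ioo hs
  have h0' : Φ.cUpN s 0 ≤ 2⁻¹ := Φ.corner_fst_le_half one_mem_Ioo hs.1
  have h1 : Φ.cUpN s 1 ∈ Ico (1 : ℝ) (1 + Φ.δs) := by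
    rw [cUpN, corner_apply_one]
    rcases le_or_gt s Φ.t1 with h | h
    · rw [Φ.χ_of_le h]; simp [hδ]
    · have hχ := Φ.χ_mem s
      have hw := Φ.ws_le
      have hq := Φ.quarter_sub_t1
      have ha : 0 ≤ 1 * Φ.κ⁻¹ * (s - Φ.t1) := mul_nonneg (by positivity) (by linarith)
      have hb : 1 * Φ.κ⁻¹ * (s - Φ.t1) < Φ.δs := by
        rw [one_mul, inv_mul_lt_iff₀ hκ]; nlinarith [hs.2]
      constructor
      · nlinarith [hχ.1]
      · calc 1 + 1 * Φ.κ⁻¹ * (s - Φ.t1) * Φ.χ s ≤ 1 + 1 * Φ.κ⁻¹ * (s - Φ.t1) * 1 := by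
              nlinarith [hχ.2]
          _ < 1 + Φ.δs := by linarith
  refine ⟨fun i ↦ ?_, h0, h0', h1⟩
  fin_cases i
  · exact ⟨by simp only [Fin.zero_eta]; linarith, by simp only [Fin.zero_eta]; linarith⟩
  · exact ⟨by simp only [Fin.mk_one]; linarith [h1.1], by simp only [Fin.mk_one]; linarith [h1.2]⟩

/-- The lower corner before the edge lies in the collar square of width `δ`, off the left edge,
in the closed northern half. [folklore] -/
theorem cLoN_mem {s : ℝ} (hs : π - s ∈ Ico (0 : ℝ) 4⁻¹) :
    Φ.cLoN s ∈ squareNhd Φ.δs ∧ 0 < Φ.cLoN s 0 ∧ Φ.cLoN s 0 ≤ 2⁻¹ ∧ Φ.cLoN s 1 ∈ Ioc (-Φ.δs) 0 := by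
  have hδ := Φ.δs_pos
  have hκ := Φ.κ_pos
  have h0 : 0 < Φ.cLoN s 0 := Φ.corner_fst_pos zero_mem_Ioo hs
  have h0' : Φ.cLoN s 0 ≤ 2⁻¹ := Φ.corner_fst_le_half zero_mem_Ioo hs.1
  have h1 : Φ.cLoN s 1 ∈ Ioc (-Φ.δs) 0 := by
    rw [cLoN, corner_apply_one]
    rcases le_or_gt (π - s) Φ.t1 with h | h
    · rw [Φ.χ_of_le h]; simp [hδ]
    · have hχ := Φ.χ_mem (π - s)
      have hw := Φ.ws_le
      have hq := Φ.quarter_sub_t1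
      have ha : 0 ≤ Φ.κ⁻¹ * (π - s - Φ.t1) := mul_nonneg (by positivity) (by linarith)
      have hb : Φ.κ⁻¹ * (π - s - Φ.t1) < Φ.δs := by
        rw [inv_mul_lt_iff₀ hκ]; nlinarith [hs.2]
      constructor
      · calc -Φ.δs < -(Φ.κ⁻¹ * (π - s - Φ.t1) * 1) := by linarith
          _ ≤ 0 + -1 * Φ.κ⁻¹ * (π - s - Φ.t1) * Φ.χ (π - s) := by nlinarith [hχ.2]
      · nlinarith [hχ.1]
  refine ⟨fun i ↦ ?_, h0, h0', h1⟩
  fin_cases i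
  · exact ⟨by simp only [Fin.zero_eta]; linarith, by simp only [Fin.zero_eta]; linarith⟩
  · exact ⟨by simp only [Fin.mk_one]; linarith [h1.1], by simp only [Fin.mk_one]; linarith [h1.2]⟩

/-- The collar square of width `δ` lies in the strip. [folklore] -/
theorem mem_strip_of_mem_squareNhd {x : 𝔼 2} (hx : x ∈ squareNhd Φ.δs) : x 1 ∈ Ioo (-1 : ℝ) 2 :=
  ⟨by linarith [(hx 1).1, Φ.δs_le_one], by linarith [(hx 1).2, Φ.δs_le_one]⟩

/-- Points of the band off the left edge (in the collar square) are not on `A`. [folklore] -/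
theorem band_not_mem_range_A {x : 𝔼 2} (hx : x ∈ squareNhd Φ.δs) (h0 : x 0 ≠ 0) :
    Φ.band x ∉ range Φ.A := fun h ↦ h0 ((Φ.band_mem_range_A_iff Φ.δs_le_nu Φ.δs_le_one hx).1 h)

/-- **The northern half-curve maps `(0, π)` into the open northern hemisphere.** [folklore] -/
theorem γNS_apply_last_pos {s : ℝ} (hs : s ∈ Ioo 0 π) : 0 < ((Φ.γNS s : 𝕊 3) : 𝔼 4) (Fin.last 3) := by
  rcases lt_or_ge s 4⁻¹ with h1 | h1
  · obtain ⟨hU, h0, h0', -⟩ := Φ.cUpN_mem ⟨hs.1.le, h1⟩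
    rw [Φ.γNS_of_le_b1 (by linarith [Φ.θsw_lt_b1, Φ.quarter_lt_θsw]),
      Φ.band_apply_last_pos_iff (Φ.mem_strip_of_mem_squareNhd hU)]
    exact Φ.corner_fst_lt_half one_mem_Ioo hs.1
  rcases le_or_gt s (π - 4⁻¹) with h2 | h2
  · rw [Φ.γNS_of_mem_Icc ⟨h1, h2⟩]
    exact Φ.A_apply_last_pos _
  · obtain ⟨hU, h0, h0', -⟩ := Φ.cLoN_mem (s := s) ⟨by linarith [hs.2], by linarith⟩
    rw [Φ.γNS_of_ge_b2 (by unfold b2; linarith [Φ.κ_pos]),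
      Φ.band_apply_last_pos_iff (Φ.mem_strip_of_mem_squareNhd hU)]
    exact Φ.corner_fst_lt_half zero_mem_Ioo (by linarith [hs.2])

/-- The two equator points of the northern half-curve. [folklore] -/
theorem γNS_zero : Φ.γNS 0 = Φ.band (pt2 2⁻¹ 1) := by
  rw [Φ.γNS_of_le_b1 (by unfold b1; linarith [Φ.κ_pos]), cUpN, Φ.corner_of_le Φ.t1_pos.le, Xr_zero]

/-- The two equator points of the northern half-curve. [folklore] -/
theorem γNS_pi : Φ.γNS π = Φ.band (pt2 2⁻¹ 0) := by
  rw [Φ.γNS_of_ge_b2 (by unfold b2; linarith [Φ.κ_pos]), cLoN, sub_self, Φ.corner_of_le Φ.t1_pos.le, Xr_zero]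

/-- `γN 0` lies on the equator. [folklore] -/
theorem γNS_zero_apply_last : ((Φ.γNS 0 : 𝕊 3) : 𝔼 4) (Fin.last 3) = 0 := by
  rw [γNS_zero, ← mem_sphereEquator_iff, Φ.band_mem_sphereEquator_iff (by norm_num)]
  rfl

/-- `γN π` lies on the equator. [folklore] -/
theorem γNS_pi_apply_last : ((Φ.γNS π : 𝕊 3) : 𝔼 4) (Fin.last 3) = 0 := by
  rw [γNS_pi, ← mem_sphereEquator_iff, Φ.band_mem_sphereEquator_iff (by norm_num)]
  rfl

/-- `γN 0 ≠ γN π` (different rays). [folklore] -/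
theorem γNS_zero_ne_pi : Φ.γNS 0 ≠ Φ.γNS π := by
  rw [γNS_zero, γNS_pi]
  intro h
  have := Φ.band_injOn (show pt2 (2⁻¹ : ℝ) 1 ∈ {x : 𝔼 2 | x 1 ∈ Ioo (-1 : ℝ) 2} by
    show (pt2 (2⁻¹ : ℝ) 1) 1 ∈ Ioo (-1 : ℝ) 2; norm_num [pt2_apply_one])
    (show pt2 (2⁻¹ : ℝ) 0 ∈ {x : 𝔼 2 | x 1 ∈ Ioo (-1 : ℝ) 2} by
    show (pt2 (2⁻¹ : ℝ) 0) 1 ∈ Ioo (-1 : ℝ) 2; norm_num [pt2_apply_one]) h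
  have := congrArg (fun q : 𝔼 2 ↦ q 1) this
  norm_num [pt2_apply_one] at this

/-- `A ∘ circlePoint` identifies parameters exactly modulo `2π`. [folklore] -/
theorem A_circlePoint_eq_iff {s t : ℝ} :
    Φ.A (circlePoint s) = Φ.A (circlePoint t) ↔ ∃ k : ℤ, s - t = 2 * π * k := by
  rw [Φ.A.injective.eq_iff]
  constructor
  · intro h
    obtain ⟨k, hk⟩ := exists_eq_add_of_circlePoint_eq h
    exact ⟨k, by linarith⟩
  · rintro ⟨k, hk⟩
    rw [show s = t + k * (2 * π) by linarith]
    exact periodic_circlePoint.int_mul k t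

/-- The span of `τ` over `[1/4, π - 1/4]` is shorter than a period. [folklore] -/
theorem τ_sub_τ_lt : Φ.τ (π - 4⁻¹) - Φ.τ 4⁻¹ < 2 * π := by
  rw [Φ.τ_of_ge (by unfold b2; linarith [Φ.κ_pos]), Φ.τ_of_le (by unfold b1; linarith [Φ.κ_pos]), Δ]
  linarith [Φ.t1_lt, Φ.κ_pos]

/-- **The northern half-curve is injective on `[0, π]`.** [folklore] -/
theorem injOn_γNS : InjOn Φ.γNS (Icc 0 π) := by
  have hq := Φ.quarter_lt_θsw
  have hq' := Φ.θsw_lt_b1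
  -- the three kinds of parameters
  have typeO : ∀ {s : ℝ}, s ∈ Icc 0 π → s < 4⁻¹ →
      Φ.γNS s = Φ.band (Φ.cUpN s) ∧ Φ.cUpN s ∈ squareNhd Φ.δs ∧ 0 < Φ.cUpN s 0 ∧ 1 ≤ Φ.cUpN s 1 :=
    fun {s} hs h1 ↦ by
      obtain ⟨hU, h0, -, h1'⟩ := Φ.cUpN_mem ⟨hs.1, h1⟩
      exact ⟨Φ.γNS_of_le_b1 (by linarith), hU, h0, h1'.1⟩
  have typeA : ∀ {s : ℝ}, s ∈ Icc (4⁻¹ : ℝ) (π - 4⁻¹) → Φ.γNS s = Φ.A (circlePoint (Φ.τ s)) :=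
    fun hs ↦ Φ.γNS_of_mem_Icc hs
  have typeO' : ∀ {s : ℝ}, s ∈ Icc 0 π → π - 4⁻¹ < s →
      Φ.γNS s = Φ.band (Φ.cLoN s) ∧ Φ.cLoN s ∈ squareNhd Φ.δs ∧ 0 < Φ.cLoN s 0 ∧ Φ.cLoN s 1 ≤ 0 :=
    fun {s} hs h1 ↦ by
      obtain ⟨hU, h0, -, h1'⟩ := Φ.cLoN_mem (s := s) ⟨by linarith [hs.2], by linarith⟩
      exact ⟨Φ.γNS_of_ge_b2 (by unfold b2; linarith [Φ.κ_pos]), hU, h0, h1'.2⟩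
  have kind : ∀ s : ℝ, s < 4⁻¹ ∨ s ∈ Icc (4⁻¹ : ℝ) (π - 4⁻¹) ∨ π - 4⁻¹ < s := fun s ↦ by
    rcases lt_or_ge s 4⁻¹ with h | h
    · exact Or.inl h
    rcases le_or_gt s (π - 4⁻¹) with h' | h'
    · exact Or.inr (Or.inl ⟨h, h'⟩)
    · exact Or.inr (Or.inr h')
  intro s hs t ht hst
  rcases kind s with hks | hks | hks <;> rcases kind t with hkt | hkt | hkt
  -- O / O : first coordinates, strictly decreasing
  · obtain ⟨hes, hUs, -, -⟩ := typeO hs hks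
    obtain ⟨het, hUt, -, -⟩ := typeO ht hkt
    rw [hes, het] at hst
    have heq := Φ.band_injOn (Φ.mem_strip_of_mem_squareNhd hUs) (Φ.mem_strip_of_mem_squareNhd hUt) hst
    have h0 := congrArg (fun q : 𝔼 2 ↦ q 0) heq
    exact (Φ.strictAntiOn_corner_fst 1 one_mem_Ioo).injOn ⟨hs.1, hks.le⟩ ⟨ht.1, hkt.le⟩ h0
  -- O / A
  · obtain ⟨hes, hUs, h0s, -⟩ := typeO hs hks
    rw [hes, typeA hkt] at hst
    exact absurd ⟨_, hst.symm⟩ (Φ.band_not_mem_range_A hUs h0s.ne')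
  -- O / O' : heights differ
  · obtain ⟨hes, hUs, -, h1s⟩ := typeO hs hks
    obtain ⟨het, hUt, -, h1t⟩ := typeO' ht hkt
    rw [hes, het] at hst
    have heq := Φ.band_injOn (Φ.mem_strip_of_mem_squareNhd hUs) (Φ.mem_strip_of_mem_squareNhd hUt) hst
    have h1 := congrArg (fun q : 𝔼 2 ↦ q 1) heq
    simp only at h1; linarith
  -- A / O
  · obtain ⟨het, hUt, h0t, -⟩ := typeO ht hkt
    rw [het, typeA hks] at hst
    exact absurd ⟨_, hst⟩ (Φ.band_not_mem_range_A hUt h0t.ne')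
  -- A / A
  · rw [typeA hks, typeA hkt, A_circlePoint_eq_iff] at hst
    obtain ⟨k, hk⟩ := hst
    have hmono := Φ.strictMono_τ
    have h1 : Φ.τ 4⁻¹ ≤ Φ.τ s := hmono.monotone hks.1
    have h2 : Φ.τ s ≤ Φ.τ (π - 4⁻¹) := hmono.monotone hks.2
    have h3 : Φ.τ 4⁻¹ ≤ Φ.τ t := hmono.monotone hkt.1
    have h4 : Φ.τ t ≤ Φ.τ (π - 4⁻¹) := hmono.monotone hkt.2
    have h5 := Φ.τ_sub_τ_lt
    have hk1 : (k : ℝ) < 1 := by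
      by_contra hc; push Not at hc; nlinarith [Real.pi_pos]
    have hk2 : (-1 : ℝ) < k := by
      by_contra hc; push Not at hc; nlinarith [Real.pi_pos]
    have hk0 : k = 0 := by
      have a : k < 1 := by exact_mod_cast hk1
      have b : -1 < k := by exact_mod_cast hk2
      omega
    rw [hk0] at hk
    simp only [Int.cast_zero, mul_zero, sub_eq_zero] at hk
    exact hmono.injective hk
  -- A / O'
  · obtain ⟨het, hUt, h0t, -⟩ := typeO' ht hkt
    rw [het, typeA hks] at hst
    exact absurd ⟨_, hst⟩ (Φ.band_not_mem_range_A hUt h0t.ne')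
  -- O' / O
  · obtain ⟨hes, hUs, -, h1s⟩ := typeO' hs hks
    obtain ⟨het, hUt, -, h1t⟩ := typeO ht hkt
    rw [hes, het] at hst
    have heq := Φ.band_injOn (Φ.mem_strip_of_mem_squareNhd hUs) (Φ.mem_strip_of_mem_squareNhd hUt) hst
    have h1 := congrArg (fun q : 𝔼 2 ↦ q 1) heq
    simp only at h1; linarith
  -- O' / A
  · obtain ⟨hes, hUs, h0s, -⟩ := typeO' hs hks
    rw [hes, typeA hkt] at hst
    exact absurd ⟨_, hst.symm⟩ (Φ.band_not_mem_range_A hUs h0s.ne')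
  -- O' / O'
  · obtain ⟨hes, hUs, -, -⟩ := typeO' hs hks
    obtain ⟨het, hUt, -, -⟩ := typeO' ht hkt
    rw [hes, het] at hst
    have heq := Φ.band_injOn (Φ.mem_strip_of_mem_squareNhd hUs) (Φ.mem_strip_of_mem_squareNhd hUt) hst
    have h0 := congrArg (fun q : 𝔼 2 ↦ q 0) heq
    have := (Φ.strictAntiOn_corner_fst (-1) zero_mem_Ioo).injOn
      (show π - s ∈ Icc (0 : ℝ) 4⁻¹ from ⟨by linarith [hs.2], by linarith⟩)
      (show π - t ∈ Icc (0 : ℝ) 4⁻¹ from ⟨by linarith [ht.2], by linarith⟩) h0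
    linarith

/-- An equator point is fixed by the reflection. [folklore] -/
theorem reflectLast_eq_self_of_apply_last {x : 𝕊 3} (hx : (x : 𝔼 4) (Fin.last 3) = 0) :
    reflectLast 3 x = x := by
  apply Subtype.ext
  ext i
  by_cases hi : i = Fin.last 3
  · subst hi; rw [reflectLast_apply_last, hx, neg_zero]
  · rw [reflectLast_apply_of_ne_last _ _ hi]

/-- **The curve on one period is injective on `(-π, π]`.** [folklore] -/
theorem injOn_GS : InjOn Φ.GS (Ioc (-π) π) := by
  -- the sign of the last coordinate tells the hemisphere
  have last_refl : ∀ x : 𝕊 3, ((reflectLast 3 x : 𝕊 3) : 𝔼 4) (Fin.last 3) = -(x : 𝔼 4) (Fin.last 3) :=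
    fun x ↦ reflectLast_apply_last 3 x
  have pos : ∀ {a : ℝ}, a ∈ Ioo 0 π → 0 < ((Φ.GS a : 𝕊 3) : 𝔼 4) (Fin.last 3) := fun {a} ha ↦ by
    rw [GS, if_pos ha.1.le]; exact Φ.γNS_apply_last_pos ha
  have neg : ∀ {a : ℝ}, a ∈ Ioo (-π) 0 → ((Φ.GS a : 𝕊 3) : 𝔼 4) (Fin.last 3) < 0 := fun {a} ha ↦ by
    rw [GS, if_neg (not_le.2 ha.2), last_refl, neg_lt_zero]
    exact Φ.γNS_apply_last_pos ⟨by linarith [ha.2], by linarith [ha.1]⟩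
  have zero : ∀ {a : ℝ}, a = 0 ∨ a = π → ((Φ.GS a : 𝕊 3) : 𝔼 4) (Fin.last 3) = 0 := fun {a} ha ↦ by
    rcases ha with rfl | rfl
    · rw [GS, if_pos le_rfl]; exact Φ.γNS_zero_apply_last
    · rw [GS, if_pos Real.pi_pos.le]; exact Φ.γNS_pi_apply_last
  have tri : ∀ {a : ℝ}, a ∈ Ioc (-π) π → a ∈ Ioo (-π) 0 ∨ (a = 0 ∨ a = π) ∨ a ∈ Ioo 0 π := fun {a} ha ↦ by
    rcases lt_trichotomy a 0 with h | h | h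
    · exact Or.inl ⟨ha.1, h⟩
    · exact Or.inr (Or.inl (Or.inl h))
    · rcases ha.2.lt_or_eq with h' | h'
      · exact Or.inr (Or.inr ⟨h, h'⟩)
      · exact Or.inr (Or.inl (Or.inr h'))
  intro a ha b hb hab
  have hlast := congrArg (fun x : 𝕊 3 ↦ (x : 𝔼 4) (Fin.last 3)) hab
  simp only at hlast
  rcases tri ha with hka | hka | hka <;> rcases tri hb with hkb | hkb | hkb
  · -- south / south
    rw [GS, if_neg (not_le.2 hka.2), GS, if_neg (not_le.2 hkb.2)] at hab
    have h := (involutive_reflectLast 3).injective hab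
    have := Φ.injOn_γNS ⟨by linarith [hka.2], by linarith [hka.1]⟩ ⟨by linarith [hkb.2], by linarith [hkb.1]⟩ h
    linarith
  · linarith [neg hka, zero hkb]
  · linarith [neg hka, pos hkb]
  · linarith [zero hka, neg hkb]
  · -- equator / equator
    rcases hka with rfl | rfl <;> rcases hkb with rfl | rfl
    · rfl
    · exfalso
      rw [GS, if_pos le_rfl, GS, if_pos Real.pi_pos.le] at hab
      exact Φ.γNS_zero_ne_pi hab
    · exfalso
      rw [GS, if_pos Real.pi_pos.le, GS, if_pos le_rfl] at hab
      exact Φ.γNS_zero_ne_pi hab.symm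
    · rfl
  · linarith [zero hka, pos hkb]
  · linarith [pos hka, neg hkb]
  · linarith [pos hka, zero hkb]
  · -- north / north
    rw [GS, if_pos hka.1.le, GS, if_pos hkb.1.le] at hab
    exact Φ.injOn_γNS ⟨hka.1.le, hka.2.le⟩ ⟨hkb.1.le, hkb.2.le⟩ hab

/-- **The symmetric curve identifies angles exactly modulo `2π`.** [folklore] -/
theorem symCurve_eq_iff {s t : ℝ} : Φ.symCurve s = Φ.symCurve t ↔ ∃ m : ℤ, t - s = m * (2 * π) := by
  constructor
  · intro h
    have h1 : Φ.GS (red s) = Φ.GS (red t) := Subtype.ext h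
    exact red_eq_red_iff.1 (Φ.injOn_GS (red_mem s) (red_mem t) h1)
  · rintro ⟨m, hm⟩
    rw [show t = s + m * (2 * π) by linarith]
    exact (Φ.periodic_symCurve.int_mul m s).symm

/-! ## The symmetric union as a knot; symmetry; sliceness -/

/-- **The symmetric union `A # (-Ā)` as a knot** (the knot of the regular simple closed curve
`symCurve`). Fox–Milnor (1966), §3, Lemma 3. [cite: FoxMilnor1966, §3 Lemma 3] -/
def symKnot : Knot :=
  Φ.isRegularClosedCurve_symCurve.toKnot fun s t hst ↦ by
    obtain ⟨m, hm⟩ := Φ.symCurve_eq_iff.1 hst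
    rw [show t = s + m * (2 * π) by linarith]
    exact (periodic_circlePoint.int_mul m s).symm

/-- The symmetric knot through the angle `θ` is `γS θ`. [folklore] -/
theorem symKnot_apply_circlePoint (θ : ℝ) : Φ.symKnot (circlePoint θ) = Φ.γS θ :=
  Subtype.ext (Φ.isRegularClosedCurve_symCurve.coe_toKnot_circlePoint _ θ)

/-- The symmetric knot through the angle `θ`, in `ℝ⁴`. [folklore] -/
theorem coe_symKnot_circlePoint (θ : ℝ) : ((Φ.symKnot (circlePoint θ) : 𝕊 3) : 𝔼 4) = Φ.symCurve θ := by
  rw [symKnot_apply_circlePoint]; rfl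

/-- The symmetry on one period: `GS (-s) = R (GS s)` for `s ∈ (-π, π)`. [folklore] -/
theorem GS_neg {s : ℝ} (hs : s ∈ Ioo (-π) π) : Φ.GS (-s) = reflectLast 3 (Φ.GS s) := by
  rcases lt_trichotomy s 0 with h | h | h
  · rw [GS, if_pos (by linarith), GS, if_neg (not_le.2 h), reflectLast_reflectLast]
  · subst h
    rw [neg_zero, GS, if_pos le_rfl, reflectLast_eq_self_of_apply_last Φ.γNS_zero_apply_last]
  · rw [GS, if_neg (by linarith), GS, if_pos h.le, neg_neg]

/-- **The curve is symmetric**: `γS (-θ) = R (γS θ)`. [folklore] -/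
theorem γS_neg (θ : ℝ) : Φ.γS (-θ) = reflectLast 3 (Φ.γS θ) := by
  obtain ⟨n, hn⟩ := exists_red_eq θ
  have hr := red_mem θ
  rw [hn] at hr
  rcases hr.2.lt_or_eq with hlt | heq
  · have hmem : -θ - (-n : ℤ) * (2 * π) ∈ Ioc (-π) π := ⟨by push_cast; linarith, by push_cast; linarith [hr.1]⟩
    have hred : red (-θ) = -(θ - n * (2 * π)) := by
      rw [red_eq_of_mem hmem]; push_cast; ring
    rw [γS, γS, hred, hn, Φ.GS_neg ⟨hr.1, hlt⟩]
  · have hmem : -θ - (-n - 1 : ℤ) * (2 * π) ∈ Ioc (-π) π :=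
      ⟨by push_cast; linarith [Real.pi_pos], by push_cast; linarith [Real.pi_pos]⟩
    have hred : red (-θ) = π := by
      rw [red_eq_of_mem hmem]; push_cast; linarith
    rw [γS, γS, hred, hn, heq, GS, if_pos Real.pi_pos.le,
      reflectLast_eq_self_of_apply_last Φ.γNS_pi_apply_last]

/-- **The symmetric union is a symmetric knot.** [folklore] -/
theorem symKnot_isSymmetric : Φ.symKnot.IsSymmetric := fun z ↦ by
  obtain ⟨θ, rfl⟩ := circlePoint_surjective z
  rw [reflectLast_one_circlePoint, symKnot_apply_circlePoint, symKnot_apply_circlePoint, γS_neg]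

/-- An angle in `(-π, π]` with positive sine lies in `(0, π)`. [folklore] -/
theorem mem_Ioo_of_sin_pos {r : ℝ} (hr : r ∈ Ioc (-π) π) (hs : 0 < Real.sin r) : r ∈ Ioo 0 π := by
  refine ⟨?_, lt_of_le_of_ne hr.2 fun h ↦ by rw [h, Real.sin_pi] at hs; exact lt_irrefl _ hs⟩
  by_contra h
  push Not at h
  have := Real.sin_nonpos_of_nonpos_of_neg_pi_le h hr.1.le
  linarith

/-- **The symmetric union maps the open upper semicircle into the open northern hemisphere.**
[folklore] -/
theorem symKnot_apply_three_pos (z : 𝕊 1) (hz : 0 < (z : 𝔼 2) 1) : 0 < ((Φ.symKnot z : 𝕊 3) : 𝔼 4) 3 := by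
  obtain ⟨θ, rfl⟩ := circlePoint_surjective z
  have hr := red_mem θ
  obtain ⟨n, hn⟩ := exists_red_eq θ
  rw [circlePoint_apply_one] at hz
  have hsin : 0 < Real.sin (red θ) := by rwa [hn, Real.sin_sub_int_mul_two_pi]
  have hmem := mem_Ioo_of_sin_pos hr hsin
  rw [symKnot_apply_circlePoint, γS, GS, if_pos hmem.1.le, show (3 : Fin 4) = Fin.last 3 from rfl]
  exact Φ.γNS_apply_last_pos hmem

/-- The germ parameter `ε = 1 - cos t₁ ∈ (0, 1]`. [folklore] -/
def εg : ℝ := 1 - Real.cos Φ.t1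

/-- `0 < ε`. [folklore] -/
theorem εg_pos : 0 < Φ.εg := by
  have : Real.cos Φ.t1 < Real.cos 0 :=
    Real.cos_lt_cos_of_nonneg_of_le_pi le_rfl (by linarith [Φ.t1_lt, Real.pi_gt_three]) Φ.t1_pos
  rw [Real.cos_zero] at this
  unfold εg; linarith

/-- `ε ≤ 1`. [folklore] -/
theorem εg_le_one : Φ.εg ≤ 1 := by
  have : 0 ≤ Real.cos Φ.t1 := (cos_pos_of_mem_Icc ⟨Φ.t1_pos.le, Φ.t1_lt.le⟩).le
  unfold εg; linarith

/-- An angle in `(-π, π]` with `cos r > cos t₁` has `|r| < t₁`. [folklore] -/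
theorem abs_lt_t1_of_cos_lt {r : ℝ} (hr : r ∈ Ioc (-π) π) (hc : Real.cos Φ.t1 < Real.cos r) : |r| < Φ.t1 := by
  by_contra h
  push Not at h
  have h1 : |r| ≤ π := abs_le.2 ⟨hr.1.le, hr.2⟩
  have := Real.cos_le_cos_of_nonneg_of_le_pi Φ.t1_pos.le h1 h
  rw [Real.cos_abs] at this
  linarith

/-- An angle in `(-π, π]` with `cos r < -cos t₁` has `π - t₁ < |r|`. [folklore] -/
theorem lt_abs_of_cos_lt {r : ℝ} (hc : Real.cos r < -Real.cos Φ.t1) : π - Φ.t1 < |r| := by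
  by_contra h
  push Not at h
  have := Real.cos_le_cos_of_nonneg_of_le_pi (abs_nonneg r) (by linarith [Φ.t1_pos]) h
  rw [Real.cos_abs, Real.cos_pi_sub] at this
  linarith

/-- **The germ at the upper equator point**: for `z₀ > 1 - ε`,
`symKnot z = z₀ · U⁻¹ â₁ + z₁ · e₃`. [folklore] -/
theorem coe_symKnot_of_gt (z : 𝕊 1) (hz : 1 - Φ.εg < (z : 𝔼 2) 0) :
    ((Φ.symKnot z : 𝕊 3) : 𝔼 4) = ((z : 𝔼 2) 0) • uvec (Φ.dir 1) + ((z : 𝔼 2) 1) • e3 := by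
  obtain ⟨θ, rfl⟩ := circlePoint_surjective z
  have hr := red_mem θ
  obtain ⟨n, hn⟩ := exists_red_eq θ
  rw [circlePoint_apply_zero, circlePoint_apply_one] at *
  have hcos : Real.cos Φ.t1 < Real.cos (red θ) := by
    rw [hn, Real.cos_sub_int_mul_two_pi]; unfold εg at hz; linarith
  have habs := Φ.abs_lt_t1_of_cos_lt hr hcos
  rw [hn] at habs
  rw [coe_symKnot_circlePoint, Φ.symCurve_of_near_zero (m := n) ⟨(abs_lt.1 habs).1, (abs_lt.1 habs).2⟩]

/-- **The germ at the lower equator point**: for `z₀ < -(1 - ε)`,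
`symKnot z = (-z₀) · U⁻¹ â₀ + z₁ · e₃`. [folklore] -/
theorem coe_symKnot_of_lt (z : 𝕊 1) (hz : (z : 𝔼 2) 0 < -(1 - Φ.εg)) :
    ((Φ.symKnot z : 𝕊 3) : 𝔼 4) = (-((z : 𝔼 2) 0)) • uvec (Φ.dir 0) + ((z : 𝔼 2) 1) • e3 := by
  obtain ⟨θ, rfl⟩ := circlePoint_surjective z
  have hr := red_mem θ
  obtain ⟨n, hn⟩ := exists_red_eq θ
  rw [circlePoint_apply_zero, circlePoint_apply_one] at *
  have hcos : Real.cos (red θ) < -Real.cos Φ.t1 := by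
    rw [hn, Real.cos_sub_int_mul_two_pi]; unfold εg at hz; linarith
  have habs := Φ.lt_abs_of_cos_lt hcos
  rw [hn] at habs hr
  rcases le_or_gt 0 (θ - n * (2 * π)) with hs | hs
  · rw [abs_of_nonneg hs] at habs
    rw [coe_symKnot_circlePoint, Φ.symCurve_of_near_pi (m := n) ⟨habs, by linarith [hr.2, Φ.t1_pos]⟩, neg_smul]
  · rw [abs_of_neg hs] at habs
    rw [coe_symKnot_circlePoint, Φ.symCurve_of_near_pi (m := n - 1)
      ⟨by push_cast; linarith [hr.1], by push_cast; linarith⟩, neg_smul]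

/-- **The symmetric union `A # (-Ā)` is smoothly slice** (by the chord disc theorem
`Knot.isSmoothlySlice_of_symmetric`: it is symmetric, its upper half lies in the northern
hemisphere, and near its two equator points it is the standard vertical great circle).
Fox–Milnor (1966), §3, Lemma 3 ("`κ + (-κ)` is a slice type") with the disc of §1; Livingston
(2005), §2.1. [cite: FoxMilnor1966, §3 Lemma 3] -/
theorem symKnot_isSmoothlySlice : Φ.symKnot.IsSmoothlySlice :=
  Knot.isSmoothlySlice_of_symmetric Φ.symKnot Φ.εg_pos Φ.εg_le_one Φ.symKnot_isSymmetric
    Φ.symKnot_apply_three_pos (fun z hz ↦ Φ.coe_symKnot_of_gt z hz) (fun z hz ↦ Φ.coe_symKnot_of_lt z hz)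

end FlatModel

end FoxMilnorModel

end Literature.Topology.FourManifolds
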